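import Literature.Analysis.FluidPDE.FujitaKatoDictionary
import HarnessLib

/-!
# The Fourier-side Duhamel term of a bounded mild solution: definition, bounds, continuity

First file of the discharge of the named fact
`Literature.Analysis.FluidPDE.bounded_mild_fujitaKato_persistence`
(`RusinSverakRhoMaxPureLe.lean`: a bounded mild solution `v ∈ C([0,T); L³) ∩ L^∞` of the
Navier–Stokes equations from a datum `u₀ ∈ Ḣ^{1/2} ∩ L²` stays in
`C([0,T); Ḣ^{1/2} ∩ L²) ∩ C([0,T); L²)`). The mechanism is the Fourier-side Duhamel formula of
Lemarié-Rieusset 2023, §8.7 (8.8), PDF p. 198, evaluated (not solved): writing `q(τ)` for the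
Fourier data of the tensor `v(τ) ⊗ v(τ) ∈ L²` (a jointly measurable field
`q : ℝ → ℝ³ → (Fin 3 → Fin 3 → ℂ)` with `sup_τ ‖q(τ)‖_{L²(dζ)} < ∞`; its construction from `v` is
the next file), the Fourier transform of `∫₀ᵗ e^{ν(t-τ)Δ} ℙ ∇·(v ⊗ v) dτ` is
`D(t, ζ) = ∫_{(0,t]} e^{-c‖ζ‖²(t-τ)} N(q(τ, ζ), ζ) dτ`, `c = (2π)²ν`, with the projected symbol
`N(X, ζ)_l = -2πi ∑_{j,k} m_{jkl}(ζ) X_{jk}` (`m_{jkl}` the tree's `FourierNS.lerayDerivSymbol`).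
This file is pure Fourier-side real analysis, independent of the Navier–Stokes equations:

* `tensorNonlin X ζ`, its bound `‖N(X, ζ)‖ ≤ C_N ‖ζ‖ ‖X‖` (`FujitaKato.enorm_symbolSum_le`),
  incompressibility `∑_l ζ_l N_l = 0`, Hermitian symmetry, and the algebra against a
  divergence-free coefficient vector `Φ` (`∑_l Φ_l N_l = -2πi ∑_{j,k} ζ_j Φ_k X_{jk}`);
* `duhamelF c q s t ζ = ∫_{(s,t]} e^{-c‖ζ‖²(t-τ)} N(q(τ,ζ), ζ) dτ` and the **weighted `L²`
  bounds** `∫ ‖ζ‖^{4a-2} ‖duhamelF c q s t ζ‖² dζ ≤ C (t-s)^{2-2a} sup_τ ‖q(τ)‖²_{L²}` for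
  `1/2 ≤ a < 1` (heat gain `e^{-c r² σ} r ≤ c^{-a} σ^{-a} r^{1-2a}`,
  `FujitaKato.exp_heat_mul_le`, Cauchy–Schwarz in `τ`, Tonelli) — `a = 1/2` is the `L²` bound,
  `a = 3/4` the `𝓕Ḣ^{1/2}` bound (Lemarié-Rieusset 2023, proof of Thm. 7.4, PDF p. 151: the
  estimates `‖∫₀ᵗ W_{ν(t-s)} * ℙ f ds‖_{Ḣ^{1/2}} ≤ C ∫₀ᵗ (ν(t-s))^{-1/4} ‖f‖₂ ds` for the
  low-frequency force, here with one more derivative);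
* the **moduli of continuity** in `L²(dζ)` and `L²(‖ζ‖ dζ)` of `t ↦ duhamelF c q 0 t` on `[0, T]`
  (splitting at `t₀`, the semigroup identity `e^{-c‖ζ‖²(t-τ)} = e^{-c‖ζ‖²(t-t₀)} e^{-c‖ζ‖²(t₀-τ)}`
  and `1 - e^{-x} ≤ x^θ`).

Everything is proved; no named facts. Two small helpers are local copies of lemmas whose
files lie outside this import closure (for the librarian to consolidate): `enorm_sub_sq_le`
(twins `Literature.Analysis.FluidPDE.enorm_sub_sq_le_two_mul`, `NSHopfLimit.lean`, and
`CylinderAubinLions.enorm_sub_sq_le_two_mul_add_two_mul`) and `heat_sub_eq_mul` (twin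
`NSFourierMild.heat_sub_sub`). Reused from the closure: `FourierProductLaw.ennreal_add_sq_le_two_mul`,
Mathlib's `enorm_sub_rev`, `FujitaKato.conjPi`, `FujitaKato.norm_le_toReal_of_enorm_le`,
`FujitaKato.exists_clm_sum_coord_mul`, `FujitaKato.sum_mul_heat_smul`.

## Mathlib / tree search

Tree (reused): `FourierNS.heat`, `FourierNS.lerayDerivSymbol` with `abs_lerayDerivSymbol_le`,
`lerayDerivSymbol_neg`, `sum_mul_lerayDerivSymbol`, `continuous_lerayDerivSymbol`
(`NSFourierWeights/Picard.lean`), `FujitaKato.nonlinC`, `FujitaKato.enorm_symbolSum_le`,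
`FujitaKato.measurable_duhamelIntegral` (`FujitaKatoPicard.lean`), `FujitaKato.exp_heat_mul_le`,
`FujitaKato.lintegral_Ioc_sub_rpow` (`FujitaKatoHeatWeights.lean`). Mathlib:
`enorm_integral_le_lintegral_enorm`, `ENNReal.lintegral_mul_le_Lp_mul_Lq`,
`lintegral_lintegral_swap`, `integral_conj`, `ContinuousLinearMap.integral_comp_comm`.

## References

* P. G. Lemarié-Rieusset, *The Navier–Stokes problem in the 21st century*, 2nd ed., CRC Press
  2023, §8.7 (8.8) (PDF p. 198), proof of Thm. 7.4 (PDF p. 151). [Lemarierieusset2023]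
* H. Fujita, T. Kato, Arch. Rational Mech. Anal. 16 (1964), 269–315. [FujitaKato1964]
-/

noncomputable section

open MeasureTheory Set Function Filter Topology Real
open scoped ENNReal NNReal ComplexConjugate

namespace Literature.Analysis.FluidPDE.Persistence

open FourierNS FujitaKato Literature.Analysis.FunctionSpaces

/-- Local notation for frequency space `ℝ³ = EuclideanSpace ℝ (Fin 3)`. -/
local notation "ℝ³" => EuclideanSpace ℝ (Fin 3)

/-! ### The projected symbol applied to a tensor -/

section TensorNonlin

/-- **The Leray-projected divergence symbol applied to a tensor**:
`N(X, ζ)_l = -2πi ∑_{j,k} m_{jkl}(ζ) X_{jk}`, the Fourier multiplier form of `ℙ ∇·F` for a tensor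
`F` with Fourier data `X` at the frequency `ζ` (Lemarié-Rieusset 2023, §8.7 (8.8): the transform
of `ℙ div(u ⊗ u)`; twin of the tree's `FourierNS.nonlin`, which is the same expression with
`X_{jk} = (v_j ⋆ w_k)(ζ)`). [cite: Lemarierieusset2023, §8.7 (8.8) (PDF p. 198)] -/
def tensorNonlin (X : Fin 3 → Fin 3 → ℂ) (ζ : ℝ³) : Fin 3 → ℂ := fun l =>
  -(2 * π * Complex.I) * ∑ j, ∑ k, (lerayDerivSymbol j k l ζ : ℂ) * X j k

/-- Unfolding a component of `tensorNonlin`. [folklore] -/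
theorem tensorNonlin_apply (X : Fin 3 → Fin 3 → ℂ) (ζ : ℝ³) (l : Fin 3) :
    tensorNonlin X ζ l = -(2 * π * Complex.I) * ∑ j, ∑ k, (lerayDerivSymbol j k l ζ : ℂ) * X j k :=
  rfl

/-- `tensorNonlin` is linear in the tensor: additive. [folklore] -/
theorem tensorNonlin_add (X Y : Fin 3 → Fin 3 → ℂ) (ζ : ℝ³) :
    tensorNonlin (X + Y) ζ = tensorNonlin X ζ + tensorNonlin Y ζ := by
  funext l
  simp only [tensorNonlin_apply, Pi.add_apply, mul_add, Finset.sum_add_distrib]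

/-- `tensorNonlin` is linear in the tensor: homogeneous. [folklore] -/
theorem tensorNonlin_smul (s : ℂ) (X : Fin 3 → Fin 3 → ℂ) (ζ : ℝ³) :
    tensorNonlin (s • X) ζ = s • tensorNonlin X ζ := by
  funext l
  simp only [tensorNonlin_apply, Pi.smul_apply, smul_eq_mul, Finset.mul_sum]
  refine Finset.sum_congr rfl fun j _ => Finset.sum_congr rfl fun k _ => ?_
  ring

/-- `tensorNonlin 0 = 0`. [folklore] -/
@[simp]
theorem tensorNonlin_zero (ζ : ℝ³) : tensorNonlin 0 ζ = 0 := by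
  funext l
  simp [tensorNonlin_apply]

/-- `tensorNonlin` of a difference. [folklore] -/
theorem tensorNonlin_sub (X Y : Fin 3 → Fin 3 → ℂ) (ζ : ℝ³) :
    tensorNonlin (X - Y) ζ = tensorNonlin X ζ - tensorNonlin Y ζ := by
  funext l
  simp only [tensorNonlin_apply, Pi.sub_apply, mul_sub, Finset.sum_sub_distrib]

/-- A coefficient of a tensor is bounded by its (sup) norm, `ℝ≥0∞` form. [folklore] -/
theorem enorm_apply_apply_le (X : Fin 3 → Fin 3 → ℂ) (j k : Fin 3) : ‖X j k‖ₑ ≤ ‖X‖ₑ := by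
  rw [← ofReal_norm, ← ofReal_norm]
  exact ENNReal.ofReal_le_ofReal ((norm_le_pi_norm (X j) k).trans (norm_le_pi_norm X j))

/-- **Bound of the projected symbol**: `‖N(X, ζ)‖ ≤ C_N ‖ζ‖ ‖X‖` with the tree's constant
`C_N = FujitaKato.nonlinC (Fin 3) = 4π · 9` (`|m_{jkl}(ζ)| ≤ 2‖ζ‖`, `abs_lerayDerivSymbol_le`,
through `FujitaKato.enorm_symbolSum_le`). [folklore] -/
theorem enorm_tensorNonlin_le (X : Fin 3 → Fin 3 → ℂ) (ζ : ℝ³) :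
    ‖tensorNonlin X ζ‖ₑ ≤ nonlinC (Fin 3) * ‖ζ‖ₑ * ‖X‖ₑ :=
  pi_enorm_le_of_forall fun l => enorm_symbolSum_le ζ l fun j k => enorm_apply_apply_le X j k

/-- **Incompressibility of the projected term**: `∑_l ζ_l N(X, ζ)_l = 0`
(`∑_l ζ_l m_{jkl}(ζ) = 0`, `sum_mul_lerayDerivSymbol`). [folklore] -/
theorem sum_coord_mul_tensorNonlin (X : Fin 3 → Fin 3 → ℂ) (ζ : ℝ³) :
    ∑ l, ((ζ l : ℝ) : ℂ) * tensorNonlin X ζ l = 0 := by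
  have key : ∀ j k, ∑ l, ((ζ l : ℝ) : ℂ) * (lerayDerivSymbol j k l ζ : ℂ) = 0 := fun j k => by
    have h := congrArg (fun r : ℝ => (r : ℂ)) (sum_mul_lerayDerivSymbol j k ζ)
    simpa [Complex.ofReal_sum, Complex.ofReal_mul] using h
  simp only [tensorNonlin_apply, Finset.mul_sum]
  calc ∑ l, ∑ j, ∑ k, ((ζ l : ℝ) : ℂ) * (-(2 * π * Complex.I) * ((lerayDerivSymbol j k l ζ : ℂ) * X j k))
      = ∑ j, ∑ k, (-(2 * π * Complex.I) * X j k) * ∑ l, ((ζ l : ℝ) : ℂ) * (lerayDerivSymbol j k l ζ : ℂ) := by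
        rw [Finset.sum_comm]
        refine Finset.sum_congr rfl fun j _ => ?_
        rw [Finset.sum_comm]
        refine Finset.sum_congr rfl fun k _ => ?_
        rw [Finset.mul_sum]
        exact Finset.sum_congr rfl fun l _ => by ring
    _ = 0 := by simp [key]

/-- **Hermitian symmetry of the projected term**: if `Y_{jk} = conj X_{jk}` (the data at `-ζ` of
a real tensor), then `N(Y, -ζ)_l = conj N(X, ζ)_l` (the symbol is real and odd,
`lerayDerivSymbol_neg`). [folklore] -/
theorem tensorNonlin_neg_of_conj {X Y : Fin 3 → Fin 3 → ℂ} (h : ∀ j k, Y j k = conj (X j k))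
    (ζ : ℝ³) (l : Fin 3) : tensorNonlin Y (-ζ) l = conj (tensorNonlin X ζ l) := by
  simp only [tensorNonlin_apply, lerayDerivSymbol_neg, map_mul, map_neg, map_sum, Complex.conj_ofReal,
    Complex.conj_I, map_ofNat, h]
  simp only [Complex.ofReal_neg, neg_mul, Finset.sum_neg_distrib, mul_neg, neg_neg]

/-- **The Leray symbol drops out against a divergence-free coefficient vector**: if
`∑_l ζ_l Φ_l = 0` then `∑_l Φ_l N(X, ζ)_l = -2πi ∑_{j,k} ζ_j Φ_k X_{jk}` (twin of
`FujitaKato.sum_mul_nonlin_eq`; Lemarié-Rieusset 2023, (8.8): the projector `Id − ξ⊗ξ/|ξ|²` is the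
identity on vectors orthogonal to `ξ`). [cite: Lemarierieusset2023, §8.7 (8.8) (PDF p. 198)] -/
theorem sum_mul_tensorNonlin_eq (X : Fin 3 → Fin 3 → ℂ) (Φ : Fin 3 → ℂ) (ζ : ℝ³)
    (hΦ : ∑ l, ((ζ l : ℝ) : ℂ) * Φ l = 0) :
    ∑ l, Φ l * tensorNonlin X ζ l =
      -(2 * π * Complex.I) * ∑ j, ∑ k, ((ζ j : ℝ) : ℂ) * Φ k * X j k := by
  -- `∑_l Φ_l m_{jkl} = ζ_j Φ_k`
  have hkey : ∀ j k, ∑ l, Φ l * (lerayDerivSymbol j k l ζ : ℂ) = ((ζ j : ℝ) : ℂ) * Φ k := by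
    intro j k
    have h1 : ∀ l, Φ l * (lerayDerivSymbol j k l ζ : ℂ) =
        ((ζ j : ℝ) : ℂ) * (if k = l then Φ l else 0) -
          ((ζ j : ℝ) : ℂ) * ((ζ k : ℝ) : ℂ) / ((‖ζ‖ ^ 2 : ℝ) : ℂ) * (((ζ l : ℝ) : ℂ) * Φ l) := by
      intro l
      rw [lerayDerivSymbol_apply]
      split_ifs with hkl
      · push_cast
        ring
      · push_cast
        ring
    simp_rw [h1]
    rw [Finset.sum_sub_distrib, ← Finset.mul_sum, ← Finset.mul_sum, Finset.sum_ite_eq,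
      if_pos (Finset.mem_univ _), hΦ, mul_zero, sub_zero]
  simp only [tensorNonlin_apply, Finset.mul_sum]
  rw [Finset.sum_comm]
  refine Finset.sum_congr rfl fun j _ => ?_
  rw [Finset.sum_comm]
  refine Finset.sum_congr rfl fun k _ => ?_
  calc ∑ l, Φ l * (-(2 * π * Complex.I) * ((lerayDerivSymbol j k l ζ : ℂ) * X j k))
      = -(2 * π * Complex.I) * X j k * ∑ l, Φ l * (lerayDerivSymbol j k l ζ : ℂ) := by
        rw [Finset.mul_sum]
        exact Finset.sum_congr rfl fun l _ => by ring
    _ = -(2 * π * Complex.I) * (((ζ j : ℝ) : ℂ) * Φ k * X j k) := by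
        rw [hkey j k]
        ring

/-- `tensorNonlin` is continuous in the tensor at a fixed frequency (a linear map on a
finite-dimensional space). [folklore] -/
theorem continuous_tensorNonlin_left (ζ : ℝ³) : Continuous fun X : Fin 3 → Fin 3 → ℂ => tensorNonlin X ζ := by
  refine continuous_pi fun l => ?_
  simp only [tensorNonlin_apply]
  refine continuous_const.mul (continuous_finsetSum _ fun j _ => continuous_finsetSum _ fun k _ => ?_)
  exact continuous_const.mul ((continuous_apply k).comp (continuous_apply j))

/-- **Joint measurability** of `(τ, ζ) ↦ N(q(τ, ζ), ζ)` for a jointly measurable tensor field `q`. [folklore] -/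
theorem measurable_tensorNonlin_uncurry {q : ℝ → ℝ³ → Fin 3 → Fin 3 → ℂ} (hq : Measurable (uncurry q)) :
    Measurable fun p : ℝ × ℝ³ => tensorNonlin (q p.1 p.2) p.2 := by
  refine measurable_pi_lambda _ fun l => ?_
  simp only [tensorNonlin_apply]
  refine Measurable.const_mul ?_ _
  refine Finset.measurable_sum _ fun j _ => Finset.measurable_sum _ fun k _ => ?_
  refine Measurable.mul ?_ ?_
  · exact (Complex.measurable_ofReal.comp (continuous_lerayDerivSymbol j k l).measurable).comp
      measurable_snd
  · exact (measurable_pi_apply k).comp ((measurable_pi_apply j).comp hq)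

end TensorNonlin

/-! ### The Fourier-side Duhamel term and its pointwise bound -/

section Duhamel

variable {c : ℝ} {q : ℝ → ℝ³ → Fin 3 → Fin 3 → ℂ} {s t : ℝ}

/-- **The Fourier-side Duhamel term** of a tensor coefficient field `q` between the times `s ≤ t`:
`D_{s,t}(ζ) = ∫_{(s,t]} e^{-c‖ζ‖²(t-τ)} N(q(τ,ζ), ζ) dτ` (Lemarié-Rieusset 2023, §8.7 (8.8), the
transform of `∫ₛᵗ W_{ν(t-τ)} * ℙ div F(τ) dτ` with `𝓕F(τ) = q(τ)`, `c = (2π)²ν`). A Bochner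
integral in `Fin 3 → ℂ`, junk `0` at the (Lebesgue-null set of) frequencies where the integrand is
not integrable in `τ`. [cite: Lemarierieusset2023, §8.7 (8.8) (PDF p. 198)] -/
def duhamelF (c : ℝ) (q : ℝ → ℝ³ → Fin 3 → Fin 3 → ℂ) (s t : ℝ) (ζ : ℝ³) : Fin 3 → ℂ :=
  ∫ τ in Ioc s t, heat c ζ (t - τ) • tensorNonlin (q τ ζ) ζ

/-- Unfolding `duhamelF`. [folklore] -/
theorem duhamelF_apply (c : ℝ) (q : ℝ → ℝ³ → Fin 3 → Fin 3 → ℂ) (s t : ℝ) (ζ : ℝ³) :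
    duhamelF c q s t ζ = ∫ τ in Ioc s t, heat c ζ (t - τ) • tensorNonlin (q τ ζ) ζ := rfl

/-- On an empty time interval the Duhamel term vanishes. [folklore] -/
theorem duhamelF_of_le (c : ℝ) (q : ℝ → ℝ³ → Fin 3 → Fin 3 → ℂ) (hts : t ≤ s) (ζ : ℝ³) :
    duhamelF c q s t ζ = 0 := by
  rw [duhamelF, Ioc_eq_empty (not_lt.2 hts), Measure.restrict_empty, integral_zero_measure]

/-- **Measurability in the frequency** of `ζ ↦ D_{0,t}(ζ)` for a jointly measurable `q`
(`FujitaKato.measurable_duhamelIntegral`). [folklore] -/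
theorem measurable_duhamelF_zero (c : ℝ) (hq : Measurable (uncurry q)) (t : ℝ) :
    Measurable (duhamelF c q 0 t) :=
  (measurable_duhamelIntegral c (N := fun p : ℝ × ℝ³ => tensorNonlin (q p.1 p.2) p.2)
    (measurable_tensorNonlin_uncurry hq)).comp (f := fun ζ : ℝ³ => (t, ζ)) (by fun_prop)

/-- The integrand of the Duhamel term is jointly measurable in `(τ, ζ)`. [folklore] -/
theorem measurable_duhamelF_integrand (c : ℝ) (hq : Measurable (uncurry q)) (t : ℝ) :
    Measurable fun p : ℝ × ℝ³ => heat c p.2 (t - p.1) • tensorNonlin (q p.1 p.2) p.2 := by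
  have hh : Measurable fun p : ℝ × ℝ³ => heat c p.2 (t - p.1) := by unfold heat; fun_prop
  refine measurable_pi_lambda _ fun l => ?_
  simp only [Pi.smul_apply, Complex.real_smul]
  exact (Complex.measurable_ofReal.comp hh).mul ((measurable_pi_apply l).comp (measurable_tensorNonlin_uncurry hq))

/-- The integrand of the Duhamel term at a fixed frequency is measurable in `τ`. [folklore] -/
theorem measurable_duhamelF_integrand_slice (c : ℝ) (hq : Measurable (uncurry q)) (t : ℝ) (ζ : ℝ³) :
    Measurable fun τ : ℝ => heat c ζ (t - τ) • tensorNonlin (q τ ζ) ζ :=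
  (measurable_duhamelF_integrand c hq t).comp (f := fun τ : ℝ => (τ, ζ)) (by fun_prop)

/-- `‖ζ‖ₑ = ENNReal.ofReal ‖ζ‖`. [folklore] -/
theorem enorm_eq_ofReal_norm (ζ : ℝ³) : ‖ζ‖ₑ = ENNReal.ofReal ‖ζ‖ := (ofReal_norm ζ).symm

/-- The norm of the Duhamel integrand: `‖e^{…} N‖ ≤ C_N (e^{-c‖ζ‖²σ} ‖ζ‖) ‖q(τ,ζ)‖`. [folklore] -/
theorem enorm_duhamelF_integrand_le (c : ℝ) (q : ℝ → ℝ³ → Fin 3 → Fin 3 → ℂ) (t τ : ℝ) (ζ : ℝ³) :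
    ‖heat c ζ (t - τ) • tensorNonlin (q τ ζ) ζ‖ₑ ≤
      nonlinC (Fin 3) * (ENNReal.ofReal (heat c ζ (t - τ) * ‖ζ‖) * ‖q τ ζ‖ₑ) := by
  rw [enorm_smul, Real.enorm_eq_ofReal (heat_nonneg _ _ _),
    ENNReal.ofReal_mul (heat_nonneg _ _ _), ← enorm_eq_ofReal_norm]
  calc ENNReal.ofReal (heat c ζ (t - τ)) * ‖tensorNonlin (q τ ζ) ζ‖ₑ
      ≤ ENNReal.ofReal (heat c ζ (t - τ)) * (nonlinC (Fin 3) * ‖ζ‖ₑ * ‖q τ ζ‖ₑ) := by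
        gcongr
        exact enorm_tensorNonlin_le _ _
    _ = nonlinC (Fin 3) * (ENNReal.ofReal (heat c ζ (t - τ)) * ‖ζ‖ₑ * ‖q τ ζ‖ₑ) := by ring

/-- **Pointwise bound of the Duhamel term**:
`‖D_{s,t}(ζ)‖ ≤ C_N ∫_{(s,t]} e^{-c‖ζ‖²(t-τ)} ‖ζ‖ ‖q(τ, ζ)‖ dτ`. [folklore] -/
theorem enorm_duhamelF_le (c : ℝ) (q : ℝ → ℝ³ → Fin 3 → Fin 3 → ℂ) (s t : ℝ) (ζ : ℝ³) :
    ‖duhamelF c q s t ζ‖ₑ ≤ nonlinC (Fin 3) *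
      ∫⁻ τ in Ioo s t, ENNReal.ofReal (heat c ζ (t - τ) * ‖ζ‖) * ‖q τ ζ‖ₑ := by
  rw [duhamelF, ← restrict_Ioo_eq_restrict_Ioc, ← lintegral_const_mul' _ _ nonlinC_ne_top]
  exact (enorm_integral_le_lintegral_enorm _).trans (lintegral_mono fun τ => enorm_duhamelF_integrand_le c q t τ ζ)

/-- **Heat gain with a frequency weight**: for `c, σ > 0` and `0 ≤ a ≤ 1`,
`‖ζ‖^{2a-1} · e^{-c‖ζ‖²σ} ‖ζ‖ ≤ c^{-a} σ^{-a}` (from `FujitaKato.exp_heat_mul_le`: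
`e^{-c r² σ} r ≤ c^{-a} σ^{-a} r^{1-2a}`). [folklore] -/
theorem weight_mul_heat_mul_norm_le {c σ a : ℝ} (hc : 0 < c) (hσ : 0 < σ) (ha0 : 0 ≤ a) (ha1 : a ≤ 1)
    (ζ : ℝ³) : ‖ζ‖ ^ (2 * a - 1) * (heat c ζ σ * ‖ζ‖) ≤ c ^ (-a) * σ ^ (-a) := by
  rcases eq_or_ne ζ 0 with rfl | hζ
  · simp only [norm_zero, mul_zero]
    positivity
  have hr : 0 < ‖ζ‖ := norm_pos_iff.2 hζ
  have h := exp_heat_mul_le hc hσ hr ha0 ha1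
  have hheat : heat c ζ σ * ‖ζ‖ = Real.exp (-(c * ‖ζ‖ ^ 2) * σ) * ‖ζ‖ := rfl
  rw [hheat]
  calc ‖ζ‖ ^ (2 * a - 1) * (Real.exp (-(c * ‖ζ‖ ^ 2) * σ) * ‖ζ‖)
      ≤ ‖ζ‖ ^ (2 * a - 1) * (c ^ (-a) * σ ^ (-a) * ‖ζ‖ ^ (1 - 2 * a)) := by gcongr
    _ = c ^ (-a) * σ ^ (-a) * (‖ζ‖ ^ (1 - 2 * a) * ‖ζ‖ ^ (2 * a - 1)) := by ring
    _ = c ^ (-a) * σ ^ (-a) := by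
        rw [← Real.rpow_add hr, show (1 - 2 * a) + (2 * a - 1) = 0 by ring, Real.rpow_zero, mul_one]

/-- **Weighted pointwise bound of the Duhamel term**: for `c > 0`, `0 ≤ a ≤ 1`,
`‖ζ‖^{2a-1} ‖D_{s,t}(ζ)‖ ≤ C_N c^{-a} ∫_{(s,t)} (t-τ)^{-a} ‖q(τ,ζ)‖ dτ`. [folklore] -/
theorem weight_mul_enorm_duhamelF_le (hc : 0 < c) {a : ℝ} (ha0 : 0 ≤ a) (ha1 : a ≤ 1)
    (q : ℝ → ℝ³ → Fin 3 → Fin 3 → ℂ) (s t : ℝ) (ζ : ℝ³) :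
    ENNReal.ofReal (‖ζ‖ ^ (2 * a - 1)) * ‖duhamelF c q s t ζ‖ₑ ≤
      nonlinC (Fin 3) * ENNReal.ofReal (c ^ (-a)) *
        ∫⁻ τ in Ioo s t, ENNReal.ofReal ((t - τ) ^ (-a)) * ‖q τ ζ‖ₑ := by
  have hw : ENNReal.ofReal (‖ζ‖ ^ (2 * a - 1)) ≠ ∞ := ENNReal.ofReal_ne_top
  have hpt : ∀ τ ∈ Ioo s t, ENNReal.ofReal (‖ζ‖ ^ (2 * a - 1)) *
      (ENNReal.ofReal (heat c ζ (t - τ) * ‖ζ‖) * ‖q τ ζ‖ₑ) ≤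
      ENNReal.ofReal (c ^ (-a)) * (ENNReal.ofReal ((t - τ) ^ (-a)) * ‖q τ ζ‖ₑ) := by
    intro τ hτ
    calc ENNReal.ofReal (‖ζ‖ ^ (2 * a - 1)) * (ENNReal.ofReal (heat c ζ (t - τ) * ‖ζ‖) * ‖q τ ζ‖ₑ)
        = ENNReal.ofReal (‖ζ‖ ^ (2 * a - 1) * (heat c ζ (t - τ) * ‖ζ‖)) * ‖q τ ζ‖ₑ := by
          rw [ENNReal.ofReal_mul (Real.rpow_nonneg (norm_nonneg _) _), mul_assoc]
      _ ≤ ENNReal.ofReal (c ^ (-a) * (t - τ) ^ (-a)) * ‖q τ ζ‖ₑ :=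
          mul_le_mul_left (ENNReal.ofReal_le_ofReal
            (weight_mul_heat_mul_norm_le hc (sub_pos.2 hτ.2) ha0 ha1 ζ)) _
      _ = ENNReal.ofReal (c ^ (-a)) * (ENNReal.ofReal ((t - τ) ^ (-a)) * ‖q τ ζ‖ₑ) := by
          rw [ENNReal.ofReal_mul (Real.rpow_nonneg hc.le _), mul_assoc]
  calc ENNReal.ofReal (‖ζ‖ ^ (2 * a - 1)) * ‖duhamelF c q s t ζ‖ₑ
      ≤ ENNReal.ofReal (‖ζ‖ ^ (2 * a - 1)) * (nonlinC (Fin 3) *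
          ∫⁻ τ in Ioo s t, ENNReal.ofReal (heat c ζ (t - τ) * ‖ζ‖) * ‖q τ ζ‖ₑ) := by
        gcongr
        exact enorm_duhamelF_le c q s t ζ
    _ = nonlinC (Fin 3) * (ENNReal.ofReal (‖ζ‖ ^ (2 * a - 1)) *
          ∫⁻ τ in Ioo s t, ENNReal.ofReal (heat c ζ (t - τ) * ‖ζ‖) * ‖q τ ζ‖ₑ) := by ring
    _ = nonlinC (Fin 3) * ∫⁻ τ in Ioo s t, ENNReal.ofReal (‖ζ‖ ^ (2 * a - 1)) *
          (ENNReal.ofReal (heat c ζ (t - τ) * ‖ζ‖) * ‖q τ ζ‖ₑ) := by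
        rw [lintegral_const_mul' _ _ hw]
    _ ≤ nonlinC (Fin 3) * ∫⁻ τ in Ioo s t, ENNReal.ofReal (c ^ (-a)) *
          (ENNReal.ofReal ((t - τ) ^ (-a)) * ‖q τ ζ‖ₑ) :=
        mul_le_mul_right (setLIntegral_mono' measurableSet_Ioo hpt) _
    _ = nonlinC (Fin 3) * ENNReal.ofReal (c ^ (-a)) *
          ∫⁻ τ in Ioo s t, ENNReal.ofReal ((t - τ) ^ (-a)) * ‖q τ ζ‖ₑ := by
        rw [lintegral_const_mul' _ _ ENNReal.ofReal_ne_top, mul_assoc]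

end Duhamel

/-! ### Power integrals and Cauchy–Schwarz in time -/

section TimeIntegrals

/-- `∫⁻_{(s,t)} (t-τ)^p dτ = (t-s)^{p+1}/(p+1)` for `p > -1`, `s ≤ t`
(`FujitaKato.lintegral_Ioc_sub_rpow` on the open interval). [folklore] -/
theorem lintegral_Ioo_sub_rpow {p s t : ℝ} (hp : -1 < p) (hst : s ≤ t) :
    ∫⁻ τ in Ioo s t, ENNReal.ofReal ((t - τ) ^ p) = ENNReal.ofReal ((t - s) ^ (p + 1) / (p + 1)) := by
  have h := lintegral_Ioc_sub_rpow (t := t) (h := t - s) hp (sub_nonneg.2 hst)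
  rw [sub_sub_cancel] at h
  rw [restrict_Ioo_eq_restrict_Ioc]
  exact h

/-- **Cauchy–Schwarz in time with the kernel `(t-τ)^{-a}`**, `a < 1`:
`∫_{(s,t)} (t-τ)^{-a} g ≤ ((t-s)^{1-a}/(1-a))^{1/2} (∫_{(s,t)} (t-τ)^{-a} g²)^{1/2}`
(split `(t-τ)^{-a} = (t-τ)^{-a/2} · (t-τ)^{-a/2}`). [folklore] -/
theorem lintegral_rpow_mul_le {s t a : ℝ} (hst : s ≤ t) (ha1 : a < 1) {g : ℝ → ℝ≥0∞}
    (hg : AEMeasurable g (volume.restrict (Ioo s t))) :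
    ∫⁻ τ in Ioo s t, ENNReal.ofReal ((t - τ) ^ (-a)) * g τ ≤
      ENNReal.ofReal ((t - s) ^ (1 - a) / (1 - a)) ^ (1 / 2 : ℝ) *
        (∫⁻ τ in Ioo s t, ENNReal.ofReal ((t - τ) ^ (-a)) * g τ ^ 2) ^ (1 / 2 : ℝ) := by
  set f : ℝ → ℝ≥0∞ := fun τ => ENNReal.ofReal ((t - τ) ^ (-a / 2)) with hf
  have hfm : AEMeasurable f (volume.restrict (Ioo s t)) := by
    rw [hf]; fun_prop
  have hff : ∀ τ ∈ Ioo s t, f τ * f τ = ENNReal.ofReal ((t - τ) ^ (-a)) := fun τ hτ => by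
    rw [hf, ← ENNReal.ofReal_mul (Real.rpow_nonneg (sub_nonneg.2 hτ.2.le) _),
      ← Real.rpow_add (sub_pos.2 hτ.2)]
    ring_nf
  -- Hölder with exponents `2, 2` for `f` and `f * g`
  have hH := ENNReal.lintegral_mul_le_Lp_mul_Lq (volume.restrict (Ioo s t))
    Real.HolderConjugate.two_two hfm (hfm.mul hg)
  have h1 : ∫⁻ τ in Ioo s t, (f * (f * g)) τ = ∫⁻ τ in Ioo s t, ENNReal.ofReal ((t - τ) ^ (-a)) * g τ :=
    setLIntegral_congr_fun measurableSet_Ioo fun τ hτ => by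
      simp only [Pi.mul_apply, ← mul_assoc, hff τ hτ]
  have h2 : ∫⁻ τ in Ioo s t, f τ ^ (2 : ℝ) = ENNReal.ofReal ((t - s) ^ (1 - a) / (1 - a)) := by
    have e : ∫⁻ τ in Ioo s t, f τ ^ (2 : ℝ) = ∫⁻ τ in Ioo s t, ENNReal.ofReal ((t - τ) ^ (-a)) :=
      setLIntegral_congr_fun measurableSet_Ioo fun τ hτ => by
        rw [show (2 : ℝ) = (2 : ℕ) by norm_num, ENNReal.rpow_natCast, sq, hff τ hτ]
    rw [e, lintegral_Ioo_sub_rpow (by linarith) hst]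
    congr 1
    ring_nf
  have h3 : ∫⁻ τ in Ioo s t, (f * g) τ ^ (2 : ℝ) = ∫⁻ τ in Ioo s t, ENNReal.ofReal ((t - τ) ^ (-a)) * g τ ^ 2 :=
    setLIntegral_congr_fun measurableSet_Ioo fun τ hτ => by
      rw [show (2 : ℝ) = (2 : ℕ) by norm_num, ENNReal.rpow_natCast, Pi.mul_apply, mul_pow, sq (f τ), hff τ hτ]
  rw [h1, h2, h3] at hH
  norm_num at hH
  exact hH

end TimeIntegrals

/-! ### The weighted `L²` bound of the Duhamel term -/

section SqBound

variable {c : ℝ} {q : ℝ → ℝ³ → Fin 3 → Fin 3 → ℂ} {s t : ℝ}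

/-- The constant of the weighted `L²` bound: `(C_N c^{-a})²`. [folklore] -/
def duhC (c a : ℝ) : ℝ≥0∞ := (nonlinC (Fin 3) * ENNReal.ofReal (c ^ (-a))) ^ 2

/-- `duhC c a < ∞`. [folklore] -/
theorem duhC_lt_top (c a : ℝ) : duhC c a < ∞ :=
  ENNReal.pow_lt_top (ENNReal.mul_lt_top (lt_top_iff_ne_top.2 nonlinC_ne_top) ENNReal.ofReal_lt_top)

/-- The time factor of the weighted `L²` bound: `((t-s)^{1-a}/(1-a))²` (as a function of
`h = t - s`). [folklore] -/
def duhT (a h : ℝ) : ℝ≥0∞ := ENNReal.ofReal (h ^ (1 - a) / (1 - a)) ^ 2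

/-- `duhT a h < ∞`. [folklore] -/
theorem duhT_lt_top (a h : ℝ) : duhT a h < ∞ := ENNReal.pow_lt_top ENNReal.ofReal_lt_top

/-- `duhT a 0 = 0` for `a < 1`. [folklore] -/
theorem duhT_zero {a : ℝ} (ha : a < 1) : duhT a 0 = 0 := by
  rw [duhT, Real.zero_rpow (by linarith), zero_div, ENNReal.ofReal_zero]
  simp

/-- `h ↦ duhT a h` is continuous on `[0, ∞)` hence tends to `0` as `h → 0⁺` (`a < 1`). [folklore] -/
theorem tendsto_duhT {a : ℝ} (ha : a < 1) : Tendsto (duhT a) (𝓝[≥] 0) (𝓝 0) := by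
  have hcont : ContinuousWithinAt (fun h : ℝ => h ^ (1 - a) / (1 - a)) (Ici 0) 0 :=
    ((Real.continuousAt_rpow_const 0 (1 - a) (Or.inr (sub_pos.2 ha).le)).div_const _).continuousWithinAt
  have h1 : Tendsto (fun h : ℝ => h ^ (1 - a) / (1 - a)) (𝓝[≥] 0) (𝓝 0) := by
    have := hcont.tendsto
    rwa [Real.zero_rpow (by linarith), zero_div] at this
  have h2 := ((ENNReal.continuous_ofReal.tendsto 0).comp h1)
  rw [ENNReal.ofReal_zero] at h2
  have h3 := (ENNReal.continuous_pow 2).tendsto 0 |>.comp h2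
  have h0 : (0 : ℝ≥0∞) ^ 2 = 0 := by simp
  rw [h0] at h3
  have hdef : duhT a = ((fun x : ℝ≥0∞ => x ^ 2) ∘ ENNReal.ofReal ∘ fun h : ℝ => h ^ (1 - a) / (1 - a)) := rfl
  rw [hdef]
  exact h3

/-- `duhT` is monotone in `h ≥ 0` (`a < 1`). [folklore] -/
theorem duhT_mono {a : ℝ} (ha : a < 1) {h h' : ℝ} (hh : 0 ≤ h) (hhh' : h ≤ h') : duhT a h ≤ duhT a h' := by
  unfold duhT
  have h1a : 0 ≤ 1 - a := (sub_pos.2 ha).le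
  gcongr

/-- **The weighted `L²` bound of the Duhamel term.** For `c > 0`, `1/2 ≤ a < 1`, a jointly
measurable tensor field `q` with `∫ ‖q(τ,ζ)‖² dζ ≤ K₂` for `τ ∈ (s, t)`, and `s ≤ t`:
`∫ ‖ζ‖^{4a-2} ‖D_{s,t}(ζ)‖² dζ ≤ (C_N c^{-a})² ((t-s)^{1-a}/(1-a))² K₂` — heat gain
(`weight_mul_enorm_duhamelF_le`), Cauchy–Schwarz in `τ` (`lintegral_rpow_mul_le`), Tonelli.
With `a = 1/2` this is the `L²(dζ)` bound, with `a = 3/4` the `L²(‖ζ‖ dζ) = 𝓕Ḣ^{1/2}` bound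
(Lemarié-Rieusset 2023, proof of Thm. 7.4, PDF p. 151). [cite: Lemarierieusset2023, Thm. 7.4 (proof, PDF p. 151)] -/
theorem lintegral_weight_sq_duhamelF_le (hc : 0 < c) {a : ℝ} (ha0 : 1 / 2 ≤ a) (ha1 : a < 1)
    (hq : Measurable (uncurry q)) {K₂ : ℝ≥0∞} (hK : ∀ τ ∈ Ioo s t, ∫⁻ ζ, ‖q τ ζ‖ₑ ^ 2 ≤ K₂)
    (hst : s ≤ t) :
    ∫⁻ ζ, ENNReal.ofReal (‖ζ‖ ^ (2 * a - 1)) ^ 2 * ‖duhamelF c q s t ζ‖ₑ ^ 2 ≤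
      duhC c a * duhT a (t - s) * K₂ := by
  set A : ℝ≥0∞ := nonlinC (Fin 3) * ENNReal.ofReal (c ^ (-a)) with hA
  set B : ℝ≥0∞ := ENNReal.ofReal ((t - s) ^ (1 - a) / (1 - a)) with hB
  set J : ℝ³ → ℝ≥0∞ := fun ζ => ∫⁻ τ in Ioo s t, ENNReal.ofReal ((t - τ) ^ (-a)) * ‖q τ ζ‖ₑ ^ 2 with hJ
  have hqm : ∀ ζ, AEMeasurable (fun τ => ‖q τ ζ‖ₑ) (volume.restrict (Ioo s t)) := fun ζ =>
    (hq.comp (f := fun τ : ℝ => (τ, ζ)) (by fun_prop)).enorm.aemeasurable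
  -- pointwise: `(W ‖D‖)² ≤ A² B J`
  have hpt : ∀ ζ, (ENNReal.ofReal (‖ζ‖ ^ (2 * a - 1)) * ‖duhamelF c q s t ζ‖ₑ) ^ 2 ≤ A ^ 2 * B * J ζ := by
    intro ζ
    have h1 := weight_mul_enorm_duhamelF_le hc (by linarith) ha1.le q s t ζ
    have h2 := lintegral_rpow_mul_le hst ha1 (hqm ζ)
    calc (ENNReal.ofReal (‖ζ‖ ^ (2 * a - 1)) * ‖duhamelF c q s t ζ‖ₑ) ^ 2
        ≤ (A * (B ^ (1 / 2 : ℝ) * (J ζ) ^ (1 / 2 : ℝ))) ^ 2 :=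
          pow_le_pow_left' (h1.trans (mul_le_mul_right h2 _)) 2
      _ = A ^ 2 * ((B ^ (1 / 2 : ℝ)) ^ 2 * ((J ζ) ^ (1 / 2 : ℝ)) ^ 2) := by ring
      _ = A ^ 2 * B * J ζ := by
          have hsq : ∀ x : ℝ≥0∞, (x ^ (1 / 2 : ℝ)) ^ 2 = x := fun x => by
            rw [← ENNReal.rpow_natCast, ← ENNReal.rpow_mul]
            norm_num
          rw [hsq, hsq, mul_assoc]
  -- Tonelli on `J`
  have hF : AEMeasurable (uncurry fun (ζ : ℝ³) (τ : ℝ) => ENNReal.ofReal ((t - τ) ^ (-a)) * ‖q τ ζ‖ₑ ^ 2)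
      ((volume : Measure ℝ³).prod (volume.restrict (Ioo s t))) := by
    have hm : Measurable (uncurry fun (ζ : ℝ³) (τ : ℝ) => ENNReal.ofReal ((t - τ) ^ (-a)) * ‖q τ ζ‖ₑ ^ 2) := by
      have h1 : Measurable fun p : ℝ³ × ℝ => ENNReal.ofReal ((t - p.2) ^ (-a)) := by fun_prop
      have h2 : Measurable fun p : ℝ³ × ℝ => ‖q p.2 p.1‖ₑ ^ 2 :=
        (hq.comp (f := fun p : ℝ³ × ℝ => (p.2, p.1)) (by fun_prop)).enorm.pow_const 2
      exact h1.mul h2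
    exact hm.aemeasurable
  have hJint : ∫⁻ ζ, J ζ ≤ B * K₂ := by
    calc ∫⁻ ζ, J ζ = ∫⁻ τ in Ioo s t, ∫⁻ ζ, ENNReal.ofReal ((t - τ) ^ (-a)) * ‖q τ ζ‖ₑ ^ 2 :=
          lintegral_lintegral_swap hF
      _ = ∫⁻ τ in Ioo s t, ENNReal.ofReal ((t - τ) ^ (-a)) * ∫⁻ ζ, ‖q τ ζ‖ₑ ^ 2 := by
          refine lintegral_congr fun τ => ?_
          rw [lintegral_const_mul' _ _ ENNReal.ofReal_ne_top]
      _ ≤ ∫⁻ τ in Ioo s t, ENNReal.ofReal ((t - τ) ^ (-a)) * K₂ :=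
          setLIntegral_mono' measurableSet_Ioo fun τ hτ => mul_le_mul_right (hK τ hτ) _
      _ = B * K₂ := by
          rw [lintegral_mul_const _ (by fun_prop), lintegral_Ioo_sub_rpow (by linarith) hst, hB]
          congr 2
          ring_nf
  have hAB : A ^ 2 * B ≠ ∞ :=
    ENNReal.mul_ne_top (ENNReal.pow_ne_top (ENNReal.mul_ne_top nonlinC_ne_top ENNReal.ofReal_ne_top))
      ENNReal.ofReal_ne_top
  calc ∫⁻ ζ, ENNReal.ofReal (‖ζ‖ ^ (2 * a - 1)) ^ 2 * ‖duhamelF c q s t ζ‖ₑ ^ 2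
      = ∫⁻ ζ, (ENNReal.ofReal (‖ζ‖ ^ (2 * a - 1)) * ‖duhamelF c q s t ζ‖ₑ) ^ 2 :=
        lintegral_congr fun ζ => by rw [mul_pow]
    _ ≤ ∫⁻ ζ, A ^ 2 * B * J ζ := lintegral_mono hpt
    _ = A ^ 2 * B * ∫⁻ ζ, J ζ := lintegral_const_mul' _ _ hAB
    _ ≤ A ^ 2 * B * (B * K₂) := mul_le_mul_right hJint _
    _ = duhC c a * duhT a (t - s) * K₂ := by
        rw [duhC, duhT, ← hA, ← hB]
        ring

end SqBound

/-! ### Good frequencies: absolute convergence of the time integrals -/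

section Good

variable {c T : ℝ} {q : ℝ → ℝ³ → Fin 3 → Fin 3 → ℂ}

/-- **The good frequencies** of a tensor coefficient field on `[0, T]`: those `ζ` at which
`τ ↦ q(τ, ζ)` is square integrable on `(0, T)`; there all Duhamel time integrals converge
absolutely. [folklore] -/
def goodFreq (q : ℝ → ℝ³ → Fin 3 → Fin 3 → ℂ) (T : ℝ) : Set ℝ³ :=
  {ζ | ∫⁻ τ in Ioo 0 T, ‖q τ ζ‖ₑ ^ 2 < ∞}

/-- **Almost every frequency is good** when `sup_{τ ∈ (0,T)} ∫ ‖q(τ,ζ)‖² dζ < ∞` (Tonelli). [folklore] -/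
theorem ae_mem_goodFreq (hq : Measurable (uncurry q)) {K₂ : ℝ≥0∞} (hK₂ : K₂ ≠ ∞)
    (hK : ∀ τ ∈ Ioo 0 T, ∫⁻ ζ, ‖q τ ζ‖ₑ ^ 2 ≤ K₂) : ∀ᵐ ζ : ℝ³ ∂volume, ζ ∈ goodFreq q T := by
  have hF : AEMeasurable (uncurry fun (ζ : ℝ³) (τ : ℝ) => ‖q τ ζ‖ₑ ^ 2)
      ((volume : Measure ℝ³).prod (volume.restrict (Ioo 0 T))) :=
    ((hq.comp (f := fun p : ℝ³ × ℝ => (p.2, p.1)) (by fun_prop)).enorm.pow_const 2).aemeasurable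
  have hfin : ∫⁻ ζ, ∫⁻ τ in Ioo 0 T, ‖q τ ζ‖ₑ ^ 2 < ∞ := by
    rw [lintegral_lintegral_swap hF]
    calc ∫⁻ τ in Ioo 0 T, ∫⁻ ζ, ‖q τ ζ‖ₑ ^ 2 ≤ ∫⁻ _τ in Ioo 0 T, K₂ := setLIntegral_mono' measurableSet_Ioo hK
      _ < ∞ := by
          rw [setLIntegral_const]
          exact ENNReal.mul_lt_top (lt_top_iff_ne_top.2 hK₂) measure_Ioo_lt_top
  have hm : Measurable fun ζ : ℝ³ => ∫⁻ τ in Ioo 0 T, ‖q τ ζ‖ₑ ^ 2 :=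
    ((hq.comp (f := fun p : ℝ³ × ℝ => (p.2, p.1)) (by fun_prop)).enorm.pow_const 2).lintegral_prod_right'
  exact ae_lt_top hm hfin.ne

/-- At a good frequency, `τ ↦ ‖q(τ, ζ)‖` is integrable on `(0, T]` (`L² ⊂ L¹` on a finite
interval). [folklore] -/
theorem integrableOn_norm_of_mem_goodFreq (hq : Measurable (uncurry q)) {ζ : ℝ³} (hζ : ζ ∈ goodFreq q T) :
    IntegrableOn (fun τ => ‖q τ ζ‖) (Ioc 0 T) := by
  have hmeas : AEStronglyMeasurable (fun τ => q τ ζ) (volume.restrict (Ioo 0 T)) :=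
    (hq.comp (f := fun τ : ℝ => (τ, ζ)) (by fun_prop)).aestronglyMeasurable
  have h2 : MemLp (fun τ => q τ ζ) 2 (volume.restrict (Ioo 0 T)) :=
    memLp_two_of_lintegral_sq_lt_top hmeas hζ
  have h1 : Integrable (fun τ => q τ ζ) (volume.restrict (Ioo 0 T)) := h2.integrable (by norm_num)
  rw [IntegrableOn, ← restrict_Ioo_eq_restrict_Ioc]
  exact h1.norm

/-- **Absolute convergence of the Duhamel integrand at a good frequency**: for `0 ≤ c`,
`0 ≤ s`, `t ≤ T` and `t ≤ t'`, `τ ↦ e^{-c‖ζ‖²(t'-τ)} N(q(τ,ζ), ζ)` is integrable on `(s, t]`. [folklore] -/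
theorem integrableOn_duhamelF_integrand (hq : Measurable (uncurry q)) {ζ : ℝ³} (hζ : ζ ∈ goodFreq q T)
    (hc : 0 ≤ c) {s t t' : ℝ} (hs : 0 ≤ s) (ht : t ≤ T) (htt' : t ≤ t') :
    IntegrableOn (fun τ => heat c ζ (t' - τ) • tensorNonlin (q τ ζ) ζ) (Ioc s t) := by
  have hsub : Ioc s t ⊆ Ioc 0 T := Ioc_subset_Ioc hs ht
  have hg : IntegrableOn (fun τ => (nonlinC (Fin 3) * ‖ζ‖ₑ).toReal * ‖q τ ζ‖) (Ioc s t) :=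
    ((integrableOn_norm_of_mem_goodFreq hq hζ).mono_set hsub).const_mul _
  refine hg.mono' ((measurable_duhamelF_integrand_slice c hq t' ζ).aestronglyMeasurable) ?_
  rw [ae_restrict_iff' measurableSet_Ioc]
  refine Eventually.of_forall fun τ hτ => ?_
  rw [norm_smul, Real.norm_of_nonneg (heat_nonneg _ _ _)]
  have hN : ‖tensorNonlin (q τ ζ) ζ‖ ≤ (nonlinC (Fin 3) * ‖ζ‖ₑ).toReal * ‖q τ ζ‖ := by
    have h := enorm_tensorNonlin_le (q τ ζ) ζ
    have hfin : nonlinC (Fin 3) * ‖ζ‖ₑ * ‖q τ ζ‖ₑ ≠ ∞ :=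
      ENNReal.mul_ne_top (ENNReal.mul_ne_top nonlinC_ne_top enorm_ne_top) enorm_ne_top
    have h' := FujitaKato.norm_le_toReal_of_enorm_le hfin h
    rwa [ENNReal.toReal_mul, toReal_enorm] at h'
  calc heat c ζ (t' - τ) * ‖tensorNonlin (q τ ζ) ζ‖ ≤ 1 * ((nonlinC (Fin 3) * ‖ζ‖ₑ).toReal * ‖q τ ζ‖) :=
        mul_le_mul (heat_le_one hc (by linarith [hτ.2]) ζ) hN (norm_nonneg _) zero_le_one
    _ = (nonlinC (Fin 3) * ‖ζ‖ₑ).toReal * ‖q τ ζ‖ := one_mul _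

/-- The heat factor is a semigroup in time: `e^{-c‖ζ‖²(t-τ)} = e^{-c‖ζ‖²(t-t₀)} e^{-c‖ζ‖²(t₀-τ)}`. [folklore] -/
theorem heat_sub_eq_mul (c : ℝ) (ζ : ℝ³) (t t₀ τ : ℝ) :
    heat c ζ (t - τ) = heat c ζ (t - t₀) * heat c ζ (t₀ - τ) := by
  simp only [heat, ← Real.exp_add]
  congr 1
  ring

/-- **Splitting of the Duhamel term at an intermediate time** (at a good frequency): for
`0 ≤ t₀ ≤ t ≤ T`, `D_{0,t} = e^{-c‖ζ‖²(t-t₀)} D_{0,t₀} + D_{t₀,t}`. [folklore] -/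
theorem duhamelF_split (hq : Measurable (uncurry q)) {ζ : ℝ³} (hζ : ζ ∈ goodFreq q T) (hc : 0 ≤ c)
    {t₀ t : ℝ} (ht₀ : 0 ≤ t₀) (ht₀t : t₀ ≤ t) (ht : t ≤ T) :
    duhamelF c q 0 t ζ = heat c ζ (t - t₀) • duhamelF c q 0 t₀ ζ + duhamelF c q t₀ t ζ := by
  have hI₁ := integrableOn_duhamelF_integrand hq hζ hc le_rfl (ht₀t.trans ht) ht₀t
  have hI₂ := integrableOn_duhamelF_integrand hq hζ hc ht₀ ht le_rfl
  rw [duhamelF, ← Ioc_union_Ioc_eq_Ioc ht₀ ht₀t,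
    setIntegral_union (Ioc_disjoint_Ioc.2 (by simp [ht₀t])) measurableSet_Ioc hI₁ hI₂, duhamelF, duhamelF,
    ← integral_smul]
  congr 1
  refine setIntegral_congr_fun measurableSet_Ioc fun τ _ => ?_
  rw [heat_sub_eq_mul c ζ t t₀ τ, mul_smul]

/-- `1 - e^{-x} ≤ x^θ` for `x ≥ 0`, `0 ≤ θ ≤ 1` (`1 - e^{-x} ≤ min(1, x)`). [folklore] -/
theorem one_sub_exp_neg_le_rpow {x θ : ℝ} (hx : 0 ≤ x) (hθ0 : 0 ≤ θ) (hθ1 : θ ≤ 1) :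
    1 - Real.exp (-x) ≤ x ^ θ := by
  have h1 : 1 - Real.exp (-x) ≤ x := by linarith [Real.add_one_le_exp (-x)]
  have h2 : 1 - Real.exp (-x) ≤ 1 := by linarith [Real.exp_pos (-x)]
  rcases le_total x 1 with hx1 | hx1
  · exact h1.trans (Real.self_le_rpow_of_le_one hx hx1 hθ1)
  · exact h2.trans (Real.one_le_rpow hx1 hθ0)

/-- **The heat factor deviates from `1` by a small power of the frequency**:
`0 ≤ 1 - e^{-c‖ζ‖²σ} ≤ (c σ)^θ ‖ζ‖^{2θ}` for `c, σ ≥ 0`, `0 ≤ θ ≤ 1`. [folklore] -/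
theorem one_sub_heat_le {c σ θ : ℝ} (hc : 0 ≤ c) (hσ : 0 ≤ σ) (hθ0 : 0 ≤ θ) (hθ1 : θ ≤ 1) (ζ : ℝ³) :
    1 - heat c ζ σ ≤ (c * σ) ^ θ * ‖ζ‖ ^ (2 * θ) := by
  have hx : 0 ≤ c * ‖ζ‖ ^ 2 * σ := by positivity
  have h := one_sub_exp_neg_le_rpow hx hθ0 hθ1
  rw [show -(c * ‖ζ‖ ^ 2 * σ) = -(c * ‖ζ‖ ^ 2) * σ by ring] at h
  refine h.trans (le_of_eq ?_)
  rw [show c * ‖ζ‖ ^ 2 * σ = (c * σ) * ‖ζ‖ ^ 2 by ring, Real.mul_rpow (by positivity) (by positivity),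
    ← Real.rpow_natCast, ← Real.rpow_mul (norm_nonneg _)]
  norm_num

/-- `0 ≤ 1 - heat`. [folklore] -/
theorem one_sub_heat_nonneg {c σ : ℝ} (hc : 0 ≤ c) (hσ : 0 ≤ σ) (ζ : ℝ³) : 0 ≤ 1 - heat c ζ σ :=
  sub_nonneg.2 (heat_le_one hc hσ ζ)

end Good

/-! ### The modulus of continuity of the Duhamel term in the weighted norms -/

section Modulus

variable {c T : ℝ} {q : ℝ → ℝ³ → Fin 3 → Fin 3 → ℂ}

/-- **The modulus of continuity** of the Duhamel term in `L²(‖ζ‖^{4a-2} dζ)`, as a function of the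
time increment `h`: `2 (C_N c^{-a})² (h^{1-a}/(1-a))² K₂ + 2 (c h)^{1/4} (C_N c^{-a'})² (T^{1-a'}/(1-a'))² K₂`,
`a' = a + 1/8`. [folklore] -/
def duhMod (c a T : ℝ) (K₂ : ℝ≥0∞) (h : ℝ) : ℝ≥0∞ :=
  2 * duhC c a * K₂ * duhT a h +
    2 * duhC c (a + 1 / 8) * duhT (a + 1 / 8) T * K₂ * ENNReal.ofReal ((c * h) ^ (1 / 4 : ℝ))

/-- The modulus tends to `0` with the increment (`a < 7/8`, `K₂ < ∞`). [folklore] -/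
theorem tendsto_duhMod {a : ℝ} (ha1 : a < 7 / 8) {K₂ : ℝ≥0∞} (hK₂ : K₂ ≠ ∞) (c T : ℝ) :
    Tendsto (duhMod c a T K₂) (𝓝[≥] 0) (𝓝 0) := by
  have h1 : Tendsto (fun h => 2 * duhC c a * K₂ * duhT a h) (𝓝[≥] 0) (𝓝 0) := by
    have := ENNReal.Tendsto.const_mul (tendsto_duhT (by linarith : a < 1)) (a := 2 * duhC c a * K₂)
      (Or.inr (ENNReal.mul_ne_top (ENNReal.mul_ne_top (by simp) (duhC_lt_top c a).ne) hK₂))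
    rwa [mul_zero] at this
  have h2 : Tendsto (fun h : ℝ => ENNReal.ofReal ((c * h) ^ (1 / 4 : ℝ))) (𝓝[≥] 0) (𝓝 0) := by
    have hcont : ContinuousAt (fun h : ℝ => (c * h) ^ (1 / 4 : ℝ)) 0 :=
      (Real.continuousAt_rpow_const _ _ (Or.inr (by norm_num))).comp (continuous_const.mul continuous_id).continuousAt
    have h := (ENNReal.continuous_ofReal.tendsto _).comp
      (tendsto_nhdsWithin_of_tendsto_nhds (s := Ici (0 : ℝ)) hcont.tendsto)
    rw [mul_zero, Real.zero_rpow (by norm_num : (1 / 4 : ℝ) ≠ 0), ENNReal.ofReal_zero] at h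
    exact h
  have h3 : Tendsto (fun h => 2 * duhC c (a + 1 / 8) * duhT (a + 1 / 8) T * K₂ * ENNReal.ofReal ((c * h) ^ (1 / 4 : ℝ)))
      (𝓝[≥] 0) (𝓝 0) := by
    have := ENNReal.Tendsto.const_mul h2 (a := 2 * duhC c (a + 1 / 8) * duhT (a + 1 / 8) T * K₂)
      (Or.inr (ENNReal.mul_ne_top (ENNReal.mul_ne_top (ENNReal.mul_ne_top (by simp)
        (duhC_lt_top c _).ne) (duhT_lt_top _ _).ne) hK₂))
    rwa [mul_zero] at this
  have h := h1.add h3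
  rw [add_zero] at h
  exact h

/-- **The modulus of continuity of the Duhamel term, ordered times.** For `c > 0`,
`1/2 ≤ a < 7/8`, `q` jointly measurable with `∫ ‖q(τ,ζ)‖² dζ ≤ K₂ < ∞` on `(0, T)`, and
`0 ≤ t₀ ≤ t ≤ T`:
`∫ ‖ζ‖^{4a-2} ‖D_{0,t}(ζ) - D_{0,t₀}(ζ)‖² dζ ≤ duhMod c a T K₂ (t - t₀)` — split
`D_{0,t} - D_{0,t₀} = D_{t₀,t} + (e^{-c‖ζ‖²(t-t₀)} - 1) D_{0,t₀}` at the good frequencies, bound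
the first piece by the weighted `L²` bound on `(t₀, t)` and the second by
`1 - e^{-c‖ζ‖²(t-t₀)} ≤ (c(t-t₀))^{1/8} ‖ζ‖^{1/4}` and the weighted bound with `a' = a + 1/8` on
`(0, t₀)`. [folklore] -/
theorem lintegral_weight_sq_duhamelF_sub_le (hc : 0 < c) {a : ℝ} (ha0 : 1 / 2 ≤ a) (ha1 : a < 7 / 8)
    (hq : Measurable (uncurry q)) {K₂ : ℝ≥0∞} (hK₂ : K₂ ≠ ∞)
    (hK : ∀ τ ∈ Ioo 0 T, ∫⁻ ζ, ‖q τ ζ‖ₑ ^ 2 ≤ K₂) {t₀ t : ℝ} (ht₀ : 0 ≤ t₀) (ht₀t : t₀ ≤ t)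
    (ht : t ≤ T) :
    ∫⁻ ζ, ENNReal.ofReal (‖ζ‖ ^ (2 * a - 1)) ^ 2 * ‖duhamelF c q 0 t ζ - duhamelF c q 0 t₀ ζ‖ₑ ^ 2 ≤
      duhMod c a T K₂ (t - t₀) := by
  set a' : ℝ := a + 1 / 8 with ha'
  set σ : ℝ := t - t₀ with hσ
  have hσ0 : 0 ≤ σ := sub_nonneg.2 ht₀t
  set W : ℝ³ → ℝ≥0∞ := fun ζ => ENNReal.ofReal (‖ζ‖ ^ (2 * a - 1)) with hW
  set W' : ℝ³ → ℝ≥0∞ := fun ζ => ENNReal.ofReal (‖ζ‖ ^ (2 * a' - 1)) with hW'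
  set E : ℝ≥0∞ := ENNReal.ofReal ((c * σ) ^ (1 / 8 : ℝ)) with hE
  -- pointwise bound at the good frequencies
  have hpt : ∀ᵐ ζ : ℝ³ ∂volume,
      W ζ ^ 2 * ‖duhamelF c q 0 t ζ - duhamelF c q 0 t₀ ζ‖ₑ ^ 2 ≤
        2 * (W ζ ^ 2 * ‖duhamelF c q t₀ t ζ‖ₑ ^ 2) + 2 * (E ^ 2 * (W' ζ ^ 2 * ‖duhamelF c q 0 t₀ ζ‖ₑ ^ 2)) := by
    filter_upwards [ae_mem_goodFreq hq hK₂ hK] with ζ hζ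
    have hsplit := duhamelF_split hq hζ hc.le ht₀ ht₀t ht
    have hdiff : duhamelF c q 0 t ζ - duhamelF c q 0 t₀ ζ =
        duhamelF c q t₀ t ζ + (heat c ζ σ - 1) • duhamelF c q 0 t₀ ζ := by
      rw [hsplit, sub_smul, one_smul, hσ]
      abel
    -- the two weighted pieces
    have hx : W ζ * ‖duhamelF c q t₀ t ζ + (heat c ζ σ - 1) • duhamelF c q 0 t₀ ζ‖ₑ ≤
        W ζ * ‖duhamelF c q t₀ t ζ‖ₑ + E * (W' ζ * ‖duhamelF c q 0 t₀ ζ‖ₑ) := by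
      calc W ζ * ‖duhamelF c q t₀ t ζ + (heat c ζ σ - 1) • duhamelF c q 0 t₀ ζ‖ₑ
          ≤ W ζ * (‖duhamelF c q t₀ t ζ‖ₑ + ‖(heat c ζ σ - 1) • duhamelF c q 0 t₀ ζ‖ₑ) := by
            gcongr
            exact enorm_add_le _ _
        _ = W ζ * ‖duhamelF c q t₀ t ζ‖ₑ + W ζ * ENNReal.ofReal (1 - heat c ζ σ) * ‖duhamelF c q 0 t₀ ζ‖ₑ := by
            rw [mul_add, enorm_smul, Real.enorm_eq_ofReal_abs, abs_sub_comm,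
              abs_of_nonneg (one_sub_heat_nonneg hc.le hσ0 ζ), mul_assoc]
        _ ≤ W ζ * ‖duhamelF c q t₀ t ζ‖ₑ + E * W' ζ * ‖duhamelF c q 0 t₀ ζ‖ₑ := by
            gcongr W ζ * ‖duhamelF c q t₀ t ζ‖ₑ + ?_ * _
            rw [hW, hE, hW', ← ENNReal.ofReal_mul (Real.rpow_nonneg (norm_nonneg _) _),
              ← ENNReal.ofReal_mul (Real.rpow_nonneg (by positivity) _)]
            refine ENNReal.ofReal_le_ofReal ?_
            calc ‖ζ‖ ^ (2 * a - 1) * (1 - heat c ζ σ)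
                ≤ ‖ζ‖ ^ (2 * a - 1) * ((c * σ) ^ (1 / 8 : ℝ) * ‖ζ‖ ^ (2 * (1 / 8 : ℝ))) := by
                  gcongr
                  exact one_sub_heat_le hc.le hσ0 (by norm_num) (by norm_num) ζ
              _ = (c * σ) ^ (1 / 8 : ℝ) * (‖ζ‖ ^ (2 * a - 1) * ‖ζ‖ ^ (2 * (1 / 8 : ℝ))) := by ring
              _ = (c * σ) ^ (1 / 8 : ℝ) * ‖ζ‖ ^ (2 * a' - 1) := by
                  rcases eq_or_ne ζ 0 with rfl | hζ0
                  · have h1 : (2 * a - 1 : ℝ) ≠ 0 ∨ (2 * (1 / 8 : ℝ)) ≠ 0 := Or.inr (by norm_num)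
                    simp only [norm_zero]
                    rw [Real.zero_rpow (by norm_num : (2 * (1 / 8 : ℝ)) ≠ 0), mul_zero,
                      Real.zero_rpow (by rw [ha']; linarith), mul_zero]
                  · rw [← Real.rpow_add (norm_pos_iff.2 hζ0)]
                    congr 1
                    rw [ha']
                    ring
        _ = W ζ * ‖duhamelF c q t₀ t ζ‖ₑ + E * (W' ζ * ‖duhamelF c q 0 t₀ ζ‖ₑ) := by rw [mul_assoc]
    calc W ζ ^ 2 * ‖duhamelF c q 0 t ζ - duhamelF c q 0 t₀ ζ‖ₑ ^ 2
        = (W ζ * ‖duhamelF c q t₀ t ζ + (heat c ζ σ - 1) • duhamelF c q 0 t₀ ζ‖ₑ) ^ 2 := by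
          rw [hdiff, mul_pow]
      _ ≤ (W ζ * ‖duhamelF c q t₀ t ζ‖ₑ + E * (W' ζ * ‖duhamelF c q 0 t₀ ζ‖ₑ)) ^ 2 := pow_le_pow_left' hx 2
      _ ≤ 2 * ((W ζ * ‖duhamelF c q t₀ t ζ‖ₑ) ^ 2 + (E * (W' ζ * ‖duhamelF c q 0 t₀ ζ‖ₑ)) ^ 2) :=
          FourierProductLaw.ennreal_add_sq_le_two_mul _ _
      _ = 2 * (W ζ ^ 2 * ‖duhamelF c q t₀ t ζ‖ₑ ^ 2) + 2 * (E ^ 2 * (W' ζ ^ 2 * ‖duhamelF c q 0 t₀ ζ‖ₑ ^ 2)) := by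
          ring
  -- integrate
  have hmeas2 : AEMeasurable (fun ζ => 2 * (E ^ 2 * (W' ζ ^ 2 * ‖duhamelF c q 0 t₀ ζ‖ₑ ^ 2))) volume := by
    have hm : Measurable fun ζ => W' ζ ^ 2 * ‖duhamelF c q 0 t₀ ζ‖ₑ ^ 2 := by
      refine Measurable.mul ?_ ((measurable_duhamelF_zero c hq t₀).enorm.pow_const 2)
      rw [hW']
      fun_prop
    exact ((hm.const_mul _).const_mul _).aemeasurable
  have hK₁ : ∀ τ ∈ Ioo t₀ t, ∫⁻ ζ, ‖q τ ζ‖ₑ ^ 2 ≤ K₂ := fun τ hτ =>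
    hK τ ⟨ht₀.trans_lt hτ.1, hτ.2.trans_le ht⟩
  have hK₀ : ∀ τ ∈ Ioo 0 t₀, ∫⁻ ζ, ‖q τ ζ‖ₑ ^ 2 ≤ K₂ := fun τ hτ =>
    hK τ ⟨hτ.1, hτ.2.trans_le (ht₀t.trans ht)⟩
  have hB₁ := lintegral_weight_sq_duhamelF_le hc ha0 (by linarith) hq hK₁ ht₀t
  have hB₀ := lintegral_weight_sq_duhamelF_le hc (a := a') (by rw [ha']; linarith) (by rw [ha']; linarith) hq hK₀ ht₀
  rw [sub_zero] at hB₀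
  have hE2 : E ^ 2 = ENNReal.ofReal ((c * σ) ^ (1 / 4 : ℝ)) := by
    rw [hE, ← ENNReal.ofReal_pow (Real.rpow_nonneg (by positivity) _), ← Real.rpow_natCast,
      ← Real.rpow_mul (by positivity)]
    norm_num
  calc ∫⁻ ζ, W ζ ^ 2 * ‖duhamelF c q 0 t ζ - duhamelF c q 0 t₀ ζ‖ₑ ^ 2
      ≤ ∫⁻ ζ, 2 * (W ζ ^ 2 * ‖duhamelF c q t₀ t ζ‖ₑ ^ 2) + 2 * (E ^ 2 * (W' ζ ^ 2 * ‖duhamelF c q 0 t₀ ζ‖ₑ ^ 2)) :=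
        lintegral_mono_ae hpt
    _ = 2 * (∫⁻ ζ, W ζ ^ 2 * ‖duhamelF c q t₀ t ζ‖ₑ ^ 2) +
          2 * (E ^ 2 * ∫⁻ ζ, W' ζ ^ 2 * ‖duhamelF c q 0 t₀ ζ‖ₑ ^ 2) := by
        rw [lintegral_add_right' _ hmeas2, lintegral_const_mul' _ _ (by simp),
          lintegral_const_mul' _ _ (by simp), lintegral_const_mul' _ _ (by rw [hE2]; exact ENNReal.ofReal_ne_top)]
    _ ≤ 2 * (duhC c a * duhT a σ * K₂) + 2 * (E ^ 2 * (duhC c a' * duhT a' t₀ * K₂)) :=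
        add_le_add (mul_le_mul_right hB₁ _) (mul_le_mul_right (mul_le_mul_right hB₀ _) _)
    _ ≤ 2 * (duhC c a * duhT a σ * K₂) + 2 * (E ^ 2 * (duhC c a' * duhT a' T * K₂)) := by
        have hmono : duhT a' t₀ ≤ duhT a' T := duhT_mono (by rw [ha']; linarith) ht₀ (ht₀t.trans ht)
        gcongr
    _ = duhMod c a T K₂ σ := by
        rw [duhMod, hE2, ← ha']
        ring

end Modulus

/-! ### The two weights `1` and `‖ζ‖`, and two-sided continuity of the Duhamel term -/

section TwoSided

variable {c T : ℝ} {q : ℝ → ℝ³ → Fin 3 → Fin 3 → ℂ}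

/-- The weight of the `L²` bound: `(‖ζ‖^{2·(1/2)-1})² = 1`. [folklore] -/
theorem weight_sq_half (ζ : ℝ³) : ENNReal.ofReal (‖ζ‖ ^ (2 * (1 / 2 : ℝ) - 1)) ^ 2 = 1 := by
  norm_num

/-- The weight of the `𝓕Ḣ^{1/2}` bound: `(‖ζ‖^{2·(3/4)-1})² = ‖ζ‖`. [folklore] -/
theorem weight_sq_threeQuarters (ζ : ℝ³) : ENNReal.ofReal (‖ζ‖ ^ (2 * (3 / 4 : ℝ) - 1)) ^ 2 = ‖ζ‖ₑ := by
  rw [← ENNReal.ofReal_pow (Real.rpow_nonneg (norm_nonneg _) _), ← Real.rpow_natCast,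
    ← Real.rpow_mul (norm_nonneg _), enorm_eq_ofReal_norm]
  norm_num

/-- `|t - t₀| → 0⁺` as `t → t₀` within any set. [folklore] -/
theorem tendsto_abs_sub_nhdsWithin (S : Set ℝ) (t₀ : ℝ) :
    Tendsto (fun t : ℝ => |t - t₀|) (𝓝[S] t₀) (𝓝[≥] 0) := by
  refine tendsto_nhdsWithin_iff.2 ⟨?_, Eventually.of_forall fun t => mem_Ici.2 (abs_nonneg _)⟩
  have hc : Continuous fun t : ℝ => |t - t₀| := (continuous_id.sub continuous_const).abs
  have h := (hc.tendsto t₀).mono_left (nhdsWithin_le_nhds (s := S))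
  simpa using h

/-- **Two-sided continuity of the Duhamel term in `L²(‖ζ‖^{4a-2} dζ)`** on `[0, T]`
(`1/2 ≤ a < 7/8`): the weighted square distance to `D_{0,t₀}` tends to `0` as `t → t₀` within
`[0, T]` (the ordered modulus `lintegral_weight_sq_duhamelF_sub_le` in both orders, and
`tendsto_duhMod`). [folklore] -/
theorem tendsto_lintegral_weight_sq_duhamelF_sub (hc : 0 < c) {a : ℝ} (ha0 : 1 / 2 ≤ a) (ha1 : a < 7 / 8)
    (hq : Measurable (uncurry q)) {K₂ : ℝ≥0∞} (hK₂ : K₂ ≠ ∞)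
    (hK : ∀ τ ∈ Ioo 0 T, ∫⁻ ζ, ‖q τ ζ‖ₑ ^ 2 ≤ K₂) {t₀ : ℝ} (ht₀ : t₀ ∈ Icc 0 T) :
    Tendsto (fun t => ∫⁻ ζ, ENNReal.ofReal (‖ζ‖ ^ (2 * a - 1)) ^ 2 *
      ‖duhamelF c q 0 t ζ - duhamelF c q 0 t₀ ζ‖ₑ ^ 2) (𝓝[Icc 0 T] t₀) (𝓝 0) := by
  have hmod : Tendsto (fun t => duhMod c a T K₂ |t - t₀|) (𝓝[Icc 0 T] t₀) (𝓝 0) :=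
    (tendsto_duhMod ha1 hK₂ c T).comp (tendsto_abs_sub_nhdsWithin _ _)
  refine tendsto_of_tendsto_of_tendsto_of_le_of_le' tendsto_const_nhds hmod
    (Eventually.of_forall fun t => bot_le) ?_
  filter_upwards [self_mem_nhdsWithin] with t ht
  rcases le_total t₀ t with h | h
  · rw [abs_of_nonneg (sub_nonneg.2 h)]
    exact lintegral_weight_sq_duhamelF_sub_le hc ha0 ha1 hq hK₂ hK ht₀.1 h ht.2
  · rw [abs_of_nonpos (sub_nonpos.2 h), neg_sub]
    calc ∫⁻ ζ, ENNReal.ofReal (‖ζ‖ ^ (2 * a - 1)) ^ 2 * ‖duhamelF c q 0 t ζ - duhamelF c q 0 t₀ ζ‖ₑ ^ 2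
        = ∫⁻ ζ, ENNReal.ofReal (‖ζ‖ ^ (2 * a - 1)) ^ 2 * ‖duhamelF c q 0 t₀ ζ - duhamelF c q 0 t ζ‖ₑ ^ 2 :=
          lintegral_congr fun ζ => by rw [enorm_sub_rev]
      _ ≤ duhMod c a T K₂ (t₀ - t) := lintegral_weight_sq_duhamelF_sub_le hc ha0 ha1 hq hK₂ hK ht.1 h ht₀.2

end TwoSided

/-! ### The free part `e^{-c‖ζ‖²t} a(ζ)` -/

section Free

variable {c T : ℝ} {a : ℝ³ → Fin 3 → ℂ}

/-- **Continuity of the free evolution in a weighted `L²`** by dominated convergence: for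
`c ≥ 0`, a finite measurable weight `ω` and data `a` with `∫ ω ‖a‖² < ∞`,
`∫ ω(ζ) ‖(e^{-c‖ζ‖²t} - e^{-c‖ζ‖²t₀}) a(ζ)‖² dζ → 0` as `t → t₀` within `[0, T]` (domination by
`ω ‖a‖²`, pointwise continuity of the heat factor). [folklore] -/
theorem tendsto_lintegral_weight_sq_heat_sub_smul (hc : 0 ≤ c) {ω : ℝ³ → ℝ≥0∞} (hω : Measurable ω)
    (hωfin : ∀ ζ, ω ζ ≠ ∞) (ha : Measurable a) (hfin : ∫⁻ ζ, ω ζ * ‖a ζ‖ₑ ^ 2 < ∞) {t₀ : ℝ}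
    (ht₀ : t₀ ∈ Icc 0 T) :
    Tendsto (fun t => ∫⁻ ζ, ω ζ * ‖(heat c ζ t - heat c ζ t₀) • a ζ‖ₑ ^ 2) (𝓝[Icc 0 T] t₀) (𝓝 0) := by
  have hlim : Tendsto (fun t => ∫⁻ ζ, ω ζ * ‖(heat c ζ t - heat c ζ t₀) • a ζ‖ₑ ^ 2) (𝓝[Icc 0 T] t₀)
      (𝓝 (∫⁻ _ζ : ℝ³, (0 : ℝ≥0∞))) := by
    refine tendsto_lintegral_filter_of_dominated_convergence (fun ζ => ω ζ * ‖a ζ‖ₑ ^ 2) ?_ ?_ hfin.ne ?_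
    · refine Eventually.of_forall fun t => ?_
      have hh : Measurable fun ζ : ℝ³ => heat c ζ t - heat c ζ t₀ := by unfold heat; fun_prop
      exact hω.mul ((hh.smul ha).enorm.pow_const 2)
    · filter_upwards [self_mem_nhdsWithin] with t ht
      refine Eventually.of_forall fun ζ => ?_
      have hb : ‖heat c ζ t - heat c ζ t₀‖ₑ ≤ 1 := by
        rw [Real.enorm_eq_ofReal_abs, ← ENNReal.ofReal_one]
        refine ENNReal.ofReal_le_ofReal (abs_sub_le_iff.2 ⟨?_, ?_⟩)
        · linarith [heat_le_one hc ht.1 ζ, heat_nonneg c ζ t₀]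
        · linarith [heat_le_one hc ht₀.1 ζ, heat_nonneg c ζ t]
      rw [enorm_smul, mul_pow]
      calc ω ζ * (‖heat c ζ t - heat c ζ t₀‖ₑ ^ 2 * ‖a ζ‖ₑ ^ 2) ≤ ω ζ * (1 ^ 2 * ‖a ζ‖ₑ ^ 2) := by gcongr
        _ = ω ζ * ‖a ζ‖ₑ ^ 2 := by rw [one_pow, one_mul]
    · refine Eventually.of_forall fun ζ => ?_
      have h1 : Continuous fun t : ℝ => (heat c ζ t - heat c ζ t₀) • a ζ := by unfold heat; fun_prop
      have h2 : Tendsto (fun t : ℝ => ‖(heat c ζ t - heat c ζ t₀) • a ζ‖ₑ ^ 2) (𝓝 t₀) (𝓝 0) := by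
        have hc2 : Continuous fun t : ℝ => ‖(heat c ζ t - heat c ζ t₀) • a ζ‖ₑ ^ 2 :=
          (ENNReal.continuous_pow 2).comp h1.enorm
        have h := hc2.tendsto t₀
        simpa using h
      have h3 := ENNReal.Tendsto.const_mul h2 (a := ω ζ) (Or.inr (hωfin ζ))
      rw [mul_zero] at h3
      exact h3.mono_left nhdsWithin_le_nhds
  simpa using hlim

end Free

/-! ### The Fourier-side candidate `ŵ = e^{-c‖ζ‖²t} a - D_{0,t}` and its class -/

section Candidate

variable {c T : ℝ} {a : ℝ³ → Fin 3 → ℂ} {q : ℝ → ℝ³ → Fin 3 → Fin 3 → ℂ}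

/-- **The Fourier-side candidate** `ŵ(t, ζ) = e^{-c‖ζ‖²t} a(ζ) - D_{0,t}(ζ)`: the right-hand side
of the transformed Duhamel formula (8.8) of Lemarié-Rieusset 2023, §8.7, evaluated on the data
`a` of the datum and the tensor data `q` of a given solution. [cite: Lemarierieusset2023, §8.7 (8.8) (PDF p. 198)] -/
def fourierCandidate (c : ℝ) (a : ℝ³ → Fin 3 → ℂ) (q : ℝ → ℝ³ → Fin 3 → Fin 3 → ℂ) (t : ℝ)
    (ζ : ℝ³) : Fin 3 → ℂ :=
  heat c ζ t • a ζ - duhamelF c q 0 t ζ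

/-- Unfolding `fourierCandidate`. [folklore] -/
theorem fourierCandidate_apply (c : ℝ) (a : ℝ³ → Fin 3 → ℂ) (q : ℝ → ℝ³ → Fin 3 → Fin 3 → ℂ) (t : ℝ)
    (ζ : ℝ³) : fourierCandidate c a q t ζ = heat c ζ t • a ζ - duhamelF c q 0 t ζ := rfl

/-- At `t = 0` the candidate is the data. [folklore] -/
theorem fourierCandidate_zero (c : ℝ) (a : ℝ³ → Fin 3 → ℂ) (q : ℝ → ℝ³ → Fin 3 → Fin 3 → ℂ) :
    fourierCandidate c a q 0 = a := by
  funext ζ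
  rw [fourierCandidate_apply, heat_zero, one_smul, duhamelF_of_le c q le_rfl, sub_zero]

/-- Time slices of the candidate are measurable. [folklore] -/
theorem measurable_fourierCandidate (c : ℝ) (ha : Measurable a) (hq : Measurable (uncurry q)) (t : ℝ) :
    Measurable (fourierCandidate c a q t) := by
  have hh : Measurable fun ζ : ℝ³ => heat c ζ t := by unfold heat; fun_prop
  exact (hh.smul ha).sub (measurable_duhamelF_zero c hq t)

/-- `‖x - y‖² ≤ 2‖x‖² + 2‖y‖²` in `ℝ≥0∞` form. [folklore] -/
theorem enorm_sub_sq_le {F : Type*} [NormedAddCommGroup F] (x y : F) :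
    ‖x - y‖ₑ ^ 2 ≤ 2 * ‖x‖ₑ ^ 2 + 2 * ‖y‖ₑ ^ 2 := by
  calc ‖x - y‖ₑ ^ 2 ≤ (‖x‖ₑ + ‖y‖ₑ) ^ 2 := pow_le_pow_left' (enorm_sub_le) 2
    _ ≤ 2 * (‖x‖ₑ ^ 2 + ‖y‖ₑ ^ 2) := FourierProductLaw.ennreal_add_sq_le_two_mul _ _
    _ = 2 * ‖x‖ₑ ^ 2 + 2 * ‖y‖ₑ ^ 2 := mul_add _ _ _

/-- Pointwise: `‖ŵ(t,ζ)‖² ≤ 2‖a(ζ)‖² + 2‖D_{0,t}(ζ)‖²` for `c, t ≥ 0`. [folklore] -/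
theorem enorm_fourierCandidate_sq_le (hc : 0 ≤ c) {t : ℝ} (ht : 0 ≤ t) (ζ : ℝ³) :
    ‖fourierCandidate c a q t ζ‖ₑ ^ 2 ≤ 2 * ‖a ζ‖ₑ ^ 2 + 2 * ‖duhamelF c q 0 t ζ‖ₑ ^ 2 := by
  refine (enorm_sub_sq_le _ _).trans ?_
  gcongr 2 * ?_ + _
  rw [enorm_smul, mul_pow]
  calc ‖heat c ζ t‖ₑ ^ 2 * ‖a ζ‖ₑ ^ 2 ≤ 1 ^ 2 * ‖a ζ‖ₑ ^ 2 := by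
        gcongr
        rw [Real.enorm_eq_ofReal (heat_nonneg _ _ _), ← ENNReal.ofReal_one]
        exact ENNReal.ofReal_le_ofReal (heat_le_one hc ht ζ)
    _ = ‖a ζ‖ₑ ^ 2 := by rw [one_pow, one_mul]

/-- **Standing hypotheses on the data** of the candidate on `[0, T]`: rate `c > 0`, measurable
`a ∈ L²(dζ) ∩ L²(‖ζ‖ dζ)`, jointly measurable `q` with `sup_{τ ∈ (0,T)} ∫ ‖q(τ,ζ)‖² dζ ≤ K₂ < ∞`. [folklore] -/
structure CandidateHyp (c T : ℝ) (a : ℝ³ → Fin 3 → ℂ) (q : ℝ → ℝ³ → Fin 3 → Fin 3 → ℂ) (K₂ : ℝ≥0∞) :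
    Prop where
  /-- The rate is positive. -/
  c_pos : 0 < c
  /-- The data is measurable. -/
  measurable_a : Measurable a
  /-- The data is square integrable. -/
  sq_a : ∫⁻ ζ, ‖a ζ‖ₑ ^ 2 < ∞
  /-- The data is in `L²(‖ζ‖ dζ)`. -/
  weighted_a : ∫⁻ ζ, ‖ζ‖ₑ * ‖a ζ‖ₑ ^ 2 < ∞
  /-- The tensor data is jointly measurable. -/
  measurable_q : Measurable (uncurry q)
  /-- The bound of the tensor data is finite. -/
  K₂_ne_top : K₂ ≠ ∞
  /-- The tensor data is uniformly square integrable on `(0, T)`. -/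
  sq_q : ∀ τ ∈ Ioo 0 T, ∫⁻ ζ, ‖q τ ζ‖ₑ ^ 2 ≤ K₂

namespace CandidateHyp

variable {K₂ : ℝ≥0∞} (h : CandidateHyp c T a q K₂)
include h

/-- The `L²(dζ)` bound of the Duhamel term on `[0, T]`. [folklore] -/
theorem lintegral_sq_duhamelF_le {t : ℝ} (ht : t ∈ Icc 0 T) :
    ∫⁻ ζ, ‖duhamelF c q 0 t ζ‖ₑ ^ 2 ≤ duhC c (1 / 2) * duhT (1 / 2) T * K₂ := by
  have hK : ∀ τ ∈ Ioo 0 t, ∫⁻ ζ, ‖q τ ζ‖ₑ ^ 2 ≤ K₂ := fun τ hτ => h.sq_q τ ⟨hτ.1, hτ.2.trans_le ht.2⟩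
  have hb := lintegral_weight_sq_duhamelF_le h.c_pos (a := 1 / 2) le_rfl (by norm_num) h.measurable_q hK ht.1
  rw [sub_zero] at hb
  have hmono := duhT_mono (by norm_num : (1 / 2 : ℝ) < 1) ht.1 ht.2
  calc ∫⁻ ζ, ‖duhamelF c q 0 t ζ‖ₑ ^ 2
      = ∫⁻ ζ, ENNReal.ofReal (‖ζ‖ ^ (2 * (1 / 2 : ℝ) - 1)) ^ 2 * ‖duhamelF c q 0 t ζ‖ₑ ^ 2 :=
        lintegral_congr fun ζ => by rw [weight_sq_half, one_mul]
    _ ≤ duhC c (1 / 2) * duhT (1 / 2) t * K₂ := hb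
    _ ≤ duhC c (1 / 2) * duhT (1 / 2) T * K₂ := by gcongr

/-- The `L²(‖ζ‖ dζ)` bound of the Duhamel term on `[0, T]`. [folklore] -/
theorem lintegral_weighted_sq_duhamelF_le {t : ℝ} (ht : t ∈ Icc 0 T) :
    ∫⁻ ζ, ‖ζ‖ₑ * ‖duhamelF c q 0 t ζ‖ₑ ^ 2 ≤ duhC c (3 / 4) * duhT (3 / 4) T * K₂ := by
  have hK : ∀ τ ∈ Ioo 0 t, ∫⁻ ζ, ‖q τ ζ‖ₑ ^ 2 ≤ K₂ := fun τ hτ => h.sq_q τ ⟨hτ.1, hτ.2.trans_le ht.2⟩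
  have hb := lintegral_weight_sq_duhamelF_le h.c_pos (a := 3 / 4) (by norm_num) (by norm_num) h.measurable_q hK ht.1
  rw [sub_zero] at hb
  have hmono := duhT_mono (by norm_num : (3 / 4 : ℝ) < 1) ht.1 ht.2
  calc ∫⁻ ζ, ‖ζ‖ₑ * ‖duhamelF c q 0 t ζ‖ₑ ^ 2
      = ∫⁻ ζ, ENNReal.ofReal (‖ζ‖ ^ (2 * (3 / 4 : ℝ) - 1)) ^ 2 * ‖duhamelF c q 0 t ζ‖ₑ ^ 2 :=
        lintegral_congr fun ζ => by rw [weight_sq_threeQuarters]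
    _ ≤ duhC c (3 / 4) * duhT (3 / 4) t * K₂ := hb
    _ ≤ duhC c (3 / 4) * duhT (3 / 4) T * K₂ := by gcongr

/-- **The candidate is square integrable**, uniformly on `[0, T]`:
`∫ ‖ŵ(t)‖² ≤ 2 ∫ ‖a‖² + 2 (C_N c^{-1/2})² (2 T^{1/2})² K₂`. [folklore] -/
theorem lintegral_sq_le {t : ℝ} (ht : t ∈ Icc 0 T) :
    ∫⁻ ζ, ‖fourierCandidate c a q t ζ‖ₑ ^ 2 ≤
      (2 * ∫⁻ ζ, ‖a ζ‖ₑ ^ 2) + 2 * (duhC c (1 / 2) * duhT (1 / 2) T * K₂) := by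
  have hD : AEMeasurable (fun ζ => 2 * ‖duhamelF c q 0 t ζ‖ₑ ^ 2) volume :=
    (((measurable_duhamelF_zero c h.measurable_q t).enorm.pow_const 2).const_mul _).aemeasurable
  calc ∫⁻ ζ, ‖fourierCandidate c a q t ζ‖ₑ ^ 2
      ≤ ∫⁻ ζ, 2 * ‖a ζ‖ₑ ^ 2 + 2 * ‖duhamelF c q 0 t ζ‖ₑ ^ 2 :=
        lintegral_mono fun ζ => enorm_fourierCandidate_sq_le h.c_pos.le ht.1 ζ
    _ = (2 * ∫⁻ ζ, ‖a ζ‖ₑ ^ 2) + 2 * ∫⁻ ζ, ‖duhamelF c q 0 t ζ‖ₑ ^ 2 := by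
        rw [lintegral_add_right' _ hD, lintegral_const_mul' _ _ (by simp), lintegral_const_mul' _ _ (by simp)]
    _ ≤ (2 * ∫⁻ ζ, ‖a ζ‖ₑ ^ 2) + 2 * (duhC c (1 / 2) * duhT (1 / 2) T * K₂) := by
        have := h.lintegral_sq_duhamelF_le ht
        gcongr

/-- **The candidate is square integrable** on `[0, T]`. [folklore] -/
theorem sq_lt_top {t : ℝ} (ht : t ∈ Icc 0 T) : ∫⁻ ζ, ‖fourierCandidate c a q t ζ‖ₑ ^ 2 < ∞ :=
  lt_of_le_of_lt (h.lintegral_sq_le ht) (ENNReal.add_lt_top.2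
    ⟨ENNReal.mul_lt_top (by simp) h.sq_a, ENNReal.mul_lt_top (by simp)
      (ENNReal.mul_lt_top (ENNReal.mul_lt_top (duhC_lt_top _ _) (duhT_lt_top _ _))
        (lt_top_iff_ne_top.2 h.K₂_ne_top))⟩)

/-- A uniform `L²` bound of the candidate on `[0, T]` (the right-hand side of
`lintegral_sq_le` as an `ℝ≥0` constant). [folklore] -/
theorem sq_le : ∃ C : ℝ≥0, ∀ t ∈ Icc 0 T, ∫⁻ ζ, ‖fourierCandidate c a q t ζ‖ₑ ^ 2 ≤ C := by
  have hfin : (2 * ∫⁻ ζ, ‖a ζ‖ₑ ^ 2) + 2 * (duhC c (1 / 2) * duhT (1 / 2) T * K₂) ≠ ∞ :=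
    (ENNReal.add_lt_top.2 ⟨ENNReal.mul_lt_top (by simp) h.sq_a, ENNReal.mul_lt_top (by simp)
      (ENNReal.mul_lt_top (ENNReal.mul_lt_top (duhC_lt_top _ _) (duhT_lt_top _ _))
        (lt_top_iff_ne_top.2 h.K₂_ne_top))⟩).ne
  refine ⟨((2 * ∫⁻ ζ, ‖a ζ‖ₑ ^ 2) + 2 * (duhC c (1 / 2) * duhT (1 / 2) T * K₂)).toNNReal, fun t ht => ?_⟩
  rw [ENNReal.coe_toNNReal hfin]
  exact h.lintegral_sq_le ht

/-- **The candidate is in `L²(‖ζ‖ dζ)`** (`= 𝓕Ḣ^{1/2}`) on `[0, T]`. [folklore] -/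
theorem weighted_lt_top {t : ℝ} (ht : t ∈ Icc 0 T) : ∫⁻ ζ, ‖ζ‖ₑ * ‖fourierCandidate c a q t ζ‖ₑ ^ 2 < ∞ := by
  have hD : AEMeasurable (fun ζ : ℝ³ => 2 * (‖ζ‖ₑ * ‖duhamelF c q 0 t ζ‖ₑ ^ 2)) volume :=
    ((measurable_enorm.mul ((measurable_duhamelF_zero c h.measurable_q t).enorm.pow_const 2)).const_mul
      _).aemeasurable
  calc ∫⁻ ζ, ‖ζ‖ₑ * ‖fourierCandidate c a q t ζ‖ₑ ^ 2
      ≤ ∫⁻ ζ, 2 * (‖ζ‖ₑ * ‖a ζ‖ₑ ^ 2) + 2 * (‖ζ‖ₑ * ‖duhamelF c q 0 t ζ‖ₑ ^ 2) :=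
        lintegral_mono fun ζ => by
          calc ‖ζ‖ₑ * ‖fourierCandidate c a q t ζ‖ₑ ^ 2
              ≤ ‖ζ‖ₑ * (2 * ‖a ζ‖ₑ ^ 2 + 2 * ‖duhamelF c q 0 t ζ‖ₑ ^ 2) := by
                gcongr
                exact enorm_fourierCandidate_sq_le h.c_pos.le ht.1 ζ
            _ = 2 * (‖ζ‖ₑ * ‖a ζ‖ₑ ^ 2) + 2 * (‖ζ‖ₑ * ‖duhamelF c q 0 t ζ‖ₑ ^ 2) := by ring
    _ = (2 * ∫⁻ ζ, ‖ζ‖ₑ * ‖a ζ‖ₑ ^ 2) + 2 * ∫⁻ ζ, ‖ζ‖ₑ * ‖duhamelF c q 0 t ζ‖ₑ ^ 2 := by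
        rw [lintegral_add_right' _ hD, lintegral_const_mul' _ _ (by simp), lintegral_const_mul' _ _ (by simp)]
    _ < ∞ := ENNReal.add_lt_top.2 ⟨ENNReal.mul_lt_top (by simp) h.weighted_a,
          ENNReal.mul_lt_top (by simp) (lt_of_le_of_lt (h.lintegral_weighted_sq_duhamelF_le ht)
            (ENNReal.mul_lt_top (ENNReal.mul_lt_top (duhC_lt_top _ _) (duhT_lt_top _ _))
              (lt_top_iff_ne_top.2 h.K₂_ne_top)))⟩

omit h in
/-- The difference of two slices of the candidate. [folklore] -/
theorem fourierCandidate_sub (t t₀ : ℝ) (ζ : ℝ³) :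
    fourierCandidate c a q t ζ - fourierCandidate c a q t₀ ζ =
      (heat c ζ t - heat c ζ t₀) • a ζ - (duhamelF c q 0 t ζ - duhamelF c q 0 t₀ ζ) := by
  simp only [fourierCandidate_apply, sub_smul]
  abel

/-- **Continuity of the candidate in `L²(dζ)`** on `[0, T]`. [cite: Lemarierieusset2023, Thm. 7.4 (A) (PDF p. 151)] -/
theorem tendsto_sq {t₀ : ℝ} (ht₀ : t₀ ∈ Icc 0 T) :
    Tendsto (fun t => ∫⁻ ζ, ‖fourierCandidate c a q t ζ - fourierCandidate c a q t₀ ζ‖ₑ ^ 2)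
      (𝓝[Icc 0 T] t₀) (𝓝 0) := by
  have hF' := tendsto_lintegral_weight_sq_heat_sub_smul h.c_pos.le (ω := fun _ => 1) measurable_const
    (fun _ => ENNReal.one_ne_top) h.measurable_a (by simpa using h.sq_a) ht₀ (T := T)
  have hF : Tendsto (fun t => ∫⁻ ζ, ‖(heat c ζ t - heat c ζ t₀) • a ζ‖ₑ ^ 2) (𝓝[Icc 0 T] t₀) (𝓝 0) := by
    simpa using hF'
  have hD' := tendsto_lintegral_weight_sq_duhamelF_sub h.c_pos (a := 1 / 2) le_rfl (by norm_num)
    h.measurable_q h.K₂_ne_top h.sq_q ht₀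
  have hD : Tendsto (fun t => ∫⁻ ζ, ‖duhamelF c q 0 t ζ - duhamelF c q 0 t₀ ζ‖ₑ ^ 2) (𝓝[Icc 0 T] t₀) (𝓝 0) := by
    refine hD'.congr fun t => lintegral_congr fun ζ => ?_
    rw [weight_sq_half, one_mul]
  have hsum : Tendsto (fun t => (2 * ∫⁻ ζ, ‖(heat c ζ t - heat c ζ t₀) • a ζ‖ₑ ^ 2) +
      2 * ∫⁻ ζ, ‖duhamelF c q 0 t ζ - duhamelF c q 0 t₀ ζ‖ₑ ^ 2) (𝓝[Icc 0 T] t₀) (𝓝 0) := by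
    have h1 := ENNReal.Tendsto.const_mul hF (a := 2) (Or.inr (by simp))
    have h2 := ENNReal.Tendsto.const_mul hD (a := 2) (Or.inr (by simp))
    rw [mul_zero] at h1 h2
    have h12 := h1.add h2
    rw [add_zero] at h12
    exact h12
  refine tendsto_of_tendsto_of_tendsto_of_le_of_le' tendsto_const_nhds hsum
    (Eventually.of_forall fun t => bot_le) (Eventually.of_forall fun t => ?_)
  have hm : AEMeasurable (fun ζ => 2 * ‖duhamelF c q 0 t ζ - duhamelF c q 0 t₀ ζ‖ₑ ^ 2) volume :=
    ((((measurable_duhamelF_zero c h.measurable_q t).sub (measurable_duhamelF_zero c h.measurable_q t₀)).enorm.pow_const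
      2).const_mul _).aemeasurable
  calc ∫⁻ ζ, ‖fourierCandidate c a q t ζ - fourierCandidate c a q t₀ ζ‖ₑ ^ 2
      ≤ ∫⁻ ζ, 2 * ‖(heat c ζ t - heat c ζ t₀) • a ζ‖ₑ ^ 2 + 2 * ‖duhamelF c q 0 t ζ - duhamelF c q 0 t₀ ζ‖ₑ ^ 2 :=
        lintegral_mono fun ζ => by rw [fourierCandidate_sub]; exact enorm_sub_sq_le _ _
    _ = (2 * ∫⁻ ζ, ‖(heat c ζ t - heat c ζ t₀) • a ζ‖ₑ ^ 2) +
          2 * ∫⁻ ζ, ‖duhamelF c q 0 t ζ - duhamelF c q 0 t₀ ζ‖ₑ ^ 2 := by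
        rw [lintegral_add_right' _ hm, lintegral_const_mul' _ _ (by simp), lintegral_const_mul' _ _ (by simp)]

/-- **Continuity of the candidate in `L²(‖ζ‖ dζ)`** (`= 𝓕Ḣ^{1/2}`) on `[0, T]`. [cite: Lemarierieusset2023, Thm. 7.4 (A) (PDF p. 151)] -/
theorem tendsto_weighted {t₀ : ℝ} (ht₀ : t₀ ∈ Icc 0 T) :
    Tendsto (fun t => ∫⁻ ζ, ‖ζ‖ₑ * ‖fourierCandidate c a q t ζ - fourierCandidate c a q t₀ ζ‖ₑ ^ 2)
      (𝓝[Icc 0 T] t₀) (𝓝 0) := by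
  have hF := tendsto_lintegral_weight_sq_heat_sub_smul h.c_pos.le (ω := fun ζ : ℝ³ => ‖ζ‖ₑ) measurable_enorm
    (fun _ => enorm_ne_top) h.measurable_a h.weighted_a ht₀ (T := T)
  have hD' := tendsto_lintegral_weight_sq_duhamelF_sub h.c_pos (a := 3 / 4) (by norm_num) (by norm_num)
    h.measurable_q h.K₂_ne_top h.sq_q ht₀
  have hD : Tendsto (fun t => ∫⁻ ζ, ‖ζ‖ₑ * ‖duhamelF c q 0 t ζ - duhamelF c q 0 t₀ ζ‖ₑ ^ 2)
      (𝓝[Icc 0 T] t₀) (𝓝 0) := by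
    refine hD'.congr fun t => lintegral_congr fun ζ => ?_
    rw [weight_sq_threeQuarters]
  have hsum : Tendsto (fun t => (2 * ∫⁻ ζ, ‖ζ‖ₑ * ‖(heat c ζ t - heat c ζ t₀) • a ζ‖ₑ ^ 2) +
      2 * ∫⁻ ζ, ‖ζ‖ₑ * ‖duhamelF c q 0 t ζ - duhamelF c q 0 t₀ ζ‖ₑ ^ 2) (𝓝[Icc 0 T] t₀) (𝓝 0) := by
    have h1 := ENNReal.Tendsto.const_mul hF (a := 2) (Or.inr (by simp))
    have h2 := ENNReal.Tendsto.const_mul hD (a := 2) (Or.inr (by simp))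
    rw [mul_zero] at h1 h2
    have h12 := h1.add h2
    rw [add_zero] at h12
    exact h12
  refine tendsto_of_tendsto_of_tendsto_of_le_of_le' tendsto_const_nhds hsum
    (Eventually.of_forall fun t => bot_le) (Eventually.of_forall fun t => ?_)
  have hm : AEMeasurable (fun ζ : ℝ³ => 2 * (‖ζ‖ₑ * ‖duhamelF c q 0 t ζ - duhamelF c q 0 t₀ ζ‖ₑ ^ 2)) volume :=
    ((measurable_enorm.mul (((measurable_duhamelF_zero c h.measurable_q t).sub
      (measurable_duhamelF_zero c h.measurable_q t₀)).enorm.pow_const 2)).const_mul _).aemeasurable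
  calc ∫⁻ ζ, ‖ζ‖ₑ * ‖fourierCandidate c a q t ζ - fourierCandidate c a q t₀ ζ‖ₑ ^ 2
      ≤ ∫⁻ ζ, 2 * (‖ζ‖ₑ * ‖(heat c ζ t - heat c ζ t₀) • a ζ‖ₑ ^ 2) +
          2 * (‖ζ‖ₑ * ‖duhamelF c q 0 t ζ - duhamelF c q 0 t₀ ζ‖ₑ ^ 2) :=
        lintegral_mono fun ζ => by
          rw [fourierCandidate_sub]
          calc ‖ζ‖ₑ * ‖(heat c ζ t - heat c ζ t₀) • a ζ - (duhamelF c q 0 t ζ - duhamelF c q 0 t₀ ζ)‖ₑ ^ 2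
              ≤ ‖ζ‖ₑ * (2 * ‖(heat c ζ t - heat c ζ t₀) • a ζ‖ₑ ^ 2 + 2 * ‖duhamelF c q 0 t ζ - duhamelF c q 0 t₀ ζ‖ₑ ^ 2) := by
                gcongr
                exact enorm_sub_sq_le _ _
            _ = _ := by ring
    _ = (2 * ∫⁻ ζ, ‖ζ‖ₑ * ‖(heat c ζ t - heat c ζ t₀) • a ζ‖ₑ ^ 2) +
          2 * ∫⁻ ζ, ‖ζ‖ₑ * ‖duhamelF c q 0 t ζ - duhamelF c q 0 t₀ ζ‖ₑ ^ 2 := by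
        rw [lintegral_add_right' _ hm, lintegral_const_mul' _ _ (by simp), lintegral_const_mul' _ _ (by simp)]

end CandidateHyp

end Candidate

/-! ### Hermitian symmetry and incompressibility of the Duhamel term and of the candidate -/

section Symmetry

variable {c T : ℝ} {a : ℝ³ → Fin 3 → ℂ} {q : ℝ → ℝ³ → Fin 3 → Fin 3 → ℂ}

/-- **Hermitian symmetry of the Duhamel term**: if `q(τ, -ζ)_{jk} = conj q(τ, ζ)_{jk}` for all
`τ, ζ` (the tensor data of a real tensor, symmetrised everywhere), then
`D_{s,t}(-ζ)_l = conj D_{s,t}(ζ)_l` at every frequency (coordinatewise conjugation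
`FujitaKato.conjPi` commutes with the Bochner integral without integrability). [folklore] -/
theorem duhamelF_neg_apply (hqc : ∀ τ ζ j k, q τ (-ζ) j k = conj (q τ ζ j k)) (s t : ℝ) (ζ : ℝ³) (l : Fin 3) :
    duhamelF c q s t (-ζ) l = conj (duhamelF c q s t ζ l) := by
  have hpt : ∀ τ, heat c (-ζ) (t - τ) • tensorNonlin (q τ (-ζ)) (-ζ) =
      conjPi (heat c ζ (t - τ) • tensorNonlin (q τ ζ) ζ) := fun τ => by
    funext l'
    rw [heat_neg, conjPi_apply, Pi.smul_apply, Pi.smul_apply, Complex.real_smul, Complex.real_smul, map_mul,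
      Complex.conj_ofReal, tensorNonlin_neg_of_conj (fun j k => hqc τ ζ j k) ζ l']
  rw [duhamelF_apply, duhamelF_apply, show (fun τ => heat c (-ζ) (t - τ) • tensorNonlin (q τ (-ζ)) (-ζ)) =
      fun τ => conjPi (heat c ζ (t - τ) • tensorNonlin (q τ ζ) ζ) from funext hpt,
    ContinuousLinearEquiv.integral_comp_comm, conjPi_apply]

/-- **Incompressibility of the Duhamel term**: `∑_l ζ_l D_{s,t}(ζ)_l = 0` at every frequency
(`∑_l ζ_l N_l = 0` under the integral, through the linear functional
`FujitaKato.exists_clm_sum_coord_mul`; the junk value `0` is also incompressible; the template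
is `FujitaKato.sum_coord_mul_duhamel_eq_zero`). [folklore] -/
theorem sum_coord_mul_duhamelF (c : ℝ) (q : ℝ → ℝ³ → Fin 3 → Fin 3 → ℂ) (s t : ℝ) (ζ : ℝ³) :
    ∑ l, ((ζ l : ℝ) : ℂ) * duhamelF c q s t ζ l = 0 := by
  obtain ⟨L, hL⟩ := exists_clm_sum_coord_mul ζ
  rw [← hL, duhamelF_apply]
  by_cases hint : Integrable (fun τ => heat c ζ (t - τ) • tensorNonlin (q τ ζ) ζ) (volume.restrict (Ioc s t))
  · rw [← L.integral_comp_comm hint]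
    refine integral_eq_zero_of_ae (Eventually.of_forall fun τ => ?_)
    show L (heat c ζ (t - τ) • tensorNonlin (q τ ζ) ζ) = 0
    rw [hL]
    simp only [Pi.smul_apply, Complex.real_smul]
    calc ∑ l, ((ζ l : ℝ) : ℂ) * ((heat c ζ (t - τ) : ℂ) * tensorNonlin (q τ ζ) ζ l)
        = (heat c ζ (t - τ) : ℂ) * ∑ l, ((ζ l : ℝ) : ℂ) * tensorNonlin (q τ ζ) ζ l := by
          rw [Finset.mul_sum]
          exact Finset.sum_congr rfl fun l _ => by ring
      _ = 0 := by rw [sum_coord_mul_tensorNonlin, mul_zero]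
  · rw [integral_undef hint, map_zero]

/-- **Hermitian symmetry of the candidate** (a.e.): from that of the data `a` (a.e.) and of the
tensor data `q` (everywhere). [folklore] -/
theorem fourierCandidate_conjSymm (ha : ∀ᵐ ζ : ℝ³ ∂volume, ∀ j, a (-ζ) j = conj (a ζ j))
    (hqc : ∀ τ ζ j k, q τ (-ζ) j k = conj (q τ ζ j k)) (t : ℝ) :
    ∀ᵐ ζ : ℝ³ ∂volume, ∀ j, fourierCandidate c a q t (-ζ) j = conj (fourierCandidate c a q t ζ j) := by
  filter_upwards [ha] with ζ hζ j
  simp only [fourierCandidate_apply, Pi.sub_apply, Pi.smul_apply, Complex.real_smul, heat_neg, hζ j,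
    duhamelF_neg_apply hqc, map_sub, map_mul, Complex.conj_ofReal]

/-- **Incompressibility of the candidate** (a.e.): `∑_l ζ_l ŵ(t,ζ)_l = 0` from `∑_l ζ_l a_l = 0`
(a.e., `FujitaKato.sum_mul_heat_smul`) and `sum_coord_mul_duhamelF`. [folklore] -/
theorem fourierCandidate_divFree (ha : ∀ᵐ ζ : ℝ³ ∂volume, ∑ j, ((ζ j : ℝ) : ℂ) * a ζ j = 0) (t : ℝ) :
    ∀ᵐ ζ : ℝ³ ∂volume, ∑ j, ((ζ j : ℝ) : ℂ) * fourierCandidate c a q t ζ j = 0 := by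
  filter_upwards [ha] with ζ hζ
  simp only [fourierCandidate_apply, Pi.sub_apply, mul_sub, Finset.sum_sub_distrib, sum_coord_mul_duhamelF,
    sub_zero]
  exact sum_mul_heat_smul hζ c t

/-- **The Duhamel formula of the candidate** (by definition):
`∫_{(0,t]} e^{-c‖ζ‖²(t-τ)} N(q(τ,ζ), ζ) dτ = e^{-c‖ζ‖²t} a(ζ) - ŵ(t, ζ)`. [folklore] -/
theorem setIntegral_eq_heat_smul_sub_fourierCandidate (c : ℝ) (a : ℝ³ → Fin 3 → ℂ)
    (q : ℝ → ℝ³ → Fin 3 → Fin 3 → ℂ) (t : ℝ) (ζ : ℝ³) :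
    ∫ τ in Ioc 0 t, heat c ζ (t - τ) • tensorNonlin (q τ ζ) ζ = heat c ζ t • a ζ - fourierCandidate c a q t ζ := by
  rw [fourierCandidate_apply, duhamelF_apply, sub_sub_cancel]

end Symmetry


end Literature.Analysis.FluidPDE.Persistence
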